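import Literature.ComputerArithmetic.RumpOgitaOishi2009.AccSumK

/-!
# Rump–Ogita–Oishi, *Accurate floating-point summation part II*: §7 rounding to nearest and directed
# rounding (Algorithm 7.1 `DownSum`/`UpSum`, eqs. (7.1)–(7.2), Lemma 7.2 with the code (7.3) and (7.4),
# Lemma 7.3, Algorithm 7.4 `NearSum`, Theorem 7.5, Remark 1)

HONEST FRAMING (ENGINES group, unit `eng-quad-4`, kernels lane of the `certquad` engine — shared
numerical engines serving client cells; rigour lives in the verifiers; every published number
belongs to a client cell's ledger, not to the engines group): §7 of Part II is typed and proved at FORMAT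
LEVEL, in the model of the lane's Part I files (`RumpOgitaOishi2008.ExtractVector`, `.AccSum`) and of
`RumpOgitaOishi2009.AccSign` (§§3–4), `.KFoldFaithful` (§5) and `.AccSumK` (§6): the tree's binary floating-point
numbers `JeannerodRump2018.IsFloat p emin` (precision `p`, gradual underflow from `emin`, NO overflow), an
ARBITRARY rounding to nearest `fl` (`IsRoundNearest p emin fl`, any tie rule), exact rational arithmetic for the
analysis. This file carries the directed-rounding and rounding-to-nearest part of the paper: ALGORITHM 7.1
(`DownSum` and its counterpart `UpSum`: `resD = max{f ∈ F : f ≤ s}`, `resU = min{f ∈ F : s ≤ f}`, "`resD = resU` is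
equivalent to `s ∈ F`"), the switching points (7.1) `M⁻(c)`, `M⁺(c)` with the rounding facts (7.2), LEMMA 7.2
(the error term `δ₁` of `FastTwoSum(τ₁, τ₂′)` in the code (7.3) tells on which side of `res` the nearest rounding
`fl(s)` can lie, (7.4)), LEMMA 7.3 (`R − δres ∈ F` and `δres ∈ epsσ′ℤ`, so that ONE further call
`TransformK(p′, R − δres)` decides `sign(s − µ)`), ALGORITHM 7.4 (`NearSum`) and THEOREM 7.5 (`NearSum(p) = fl(s)`,
the rounded-to-nearest exact sum), with REMARK 1 (the operations `res − τ₁`, `τ₂ − (res − τ₁)`, `pred(res) − res`,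
`γ/2`, `R − δ′` of Algorithm 7.4 commit no rounding error) — all PROVED, sorry-free, for every precision and
exponent range admitted by the printed hypothesis `2^(2M)eps ≤ 1`. No hardware, timing, flop-count or IEEE-format
claims: `p` and `emin` are parameters; `pred`/`succ` are parameters specified by their defining property (Remark 4).

Source read at the page: [RumpOgitaOishi2009] S. M. Rump, T. Ogita, S. Oishi, *Accurate floating-point
summation part II: sign, K-fold faithful and rounding to nearest*, SIAM J. Sci. Comput. 31(2) (2008/09)
1269–1302, doi:10.1137/07068816X; read in the authors' version (30 pp.; its page numbers are used): p. 15 (§7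
introduction: `resD`, `resU`, "`resD = resU` is equivalent to `s ∈ F`"; Algorithm 7.1 `DownSum`, "its counterpart
looks similarly", "the proof of correctness follows straightforwardly by Lemma 6.3 and the definition of faithful
rounding"; the definitions (7.1) of `M⁻(c)`, `M⁺(c)` and the five implications (7.2); the discussion of
`sign(res − s)`; Lemma 7.2 with the code (7.3) and (7.4); the proof of Lemma 7.2, first half: `res` of (7.3) is the
`res` of (3.7) for `ϱ = 0`, Lemma 3.5, the case `σ ≤ ½eps⁻¹eta`), p. 16 (proof of Lemma 7.2, second half: `|τ₂′| <
|τ₁|` by (3.15), `res + δ₁ = τ₁ + τ₂′` by Lemma 2.5, `s = res + δ₁ + δ < res + ½eps|res| ≤ M⁺(res)` by (3.13),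
(3.17); the discussion "`µ` is not a floating-point number but could only be subtracted in two parts",
`s − µ = R + Σ p′ᵢ − δres`; Lemma 7.3; its proof: `Δ = res − τ₁`, `R = τ₂ − Δ`, the case `σ ≤ ½eps⁻¹eta`
(`p′ = 0`, `res = τ₁`, `R = τ₂`, "`m > 1`", `|res| = |τ₁| < 2ᴹσ ≤ 2^(M−1)eps⁻¹eta`), then `σ > ½eps⁻¹eta` with
(7.5), (7.6), `|res| > ⅝|τ₁| > 2^(2M−1)epsσ`, `δres ∈ 2ᴹeps²σℤ ⊆ epsσ′ℤ`, the case `|τ₁| < σ` (`τ₂ = 0`) with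
(7.7)), p. 17 (end of the case `|τ₁| < σ`: `|R − δres| ≤ 2^(−M+1)ufp(res) ≤ ½ufp(res)`; the case `|τ₁| ≥ σ` with
(7.8) and its subcases `|res| ≤ σ` and `|res| > σ`, the latter using `t⁽⁰⁾ = ϱ = 0`: `|τ₁| < (1 + eps)(2ᴹ + 1)σ`,
`|res| < (2ᴹ + 3)σ`; "Lemma 7.3 does not remain true for `ϱ ≠ 0`" (`ϱ = 1`, `p = (eps²)`, `δres = −eps`);
Algorithm 7.4 `NearSum`), p. 18 (Theorem 7.5; Remarks 1–4; the proof of Theorem 7.5; the discussion of the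
computing times `t_N` vs `t_f`; the K-fold rounded-to-nearest variant). Also used: pp. 5–8 (Theorem 3.2 /
Lemma 3.4, Lemma 3.5 with (3.7)–(3.17), typed in `AccSign`), pp. 12–13 (Algorithm 6.2, Lemma 6.3 with
(6.1)–(6.3), typed in `AccSumK`), Part I §2 (`pred`, `succ`, `ufp`, (2.4)–(2.10), Definition 2.3; typed in
`RumpOgitaOishi2008.ExtractVector` / `.AccSum`).

DICTIONARY (source ↦ here; carrier `ℚ`; the dictionaries of `ExtractVector`, `AccSum`, `AccSign`, `KFoldFaithful`
and `AccSumK` — `F ↦ IsFloat p emin`, `fl ↦ fl` with `IsRoundNearest p emin fl`, `eps ↦ unitRoundoff p = 2^-p`,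
`eta ↦ 2^emin`, `½eps⁻¹eta ↦ 2^(emin+p-1)`, `f ∈ U ↦ |f| ≤ 2^(emin+p-1)`, `ufp ↦ RumpOgitaOishi2008.ufp`,
`gℤ ↦ OnGrid g`, `f ∈ □(r) ↦ IsFaithfulRounding p emin f r`, `pred(f) = g ↦ IsPred p emin f g`, `succ(f) = g ↦
IsSucc p emin f g`, `μ = max |pᵢ| ↦ maxAbs xs`, `M = ⌈log₂(n + 2)⌉ ↦ Nat.clog 2 (xs.length + 2)`, `⌈log₂ μ′⌉ ↦
Int.clog 2 (maxAbs p′)`, `2^(2M)eps ≤ 1 ↦ 2 * Nat.clog 2 (xs.length + 2) ≤ p`, `Transform(p, ϱ)` with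
`Φ = 2^(2M)eps ↦ transformPhi fl p emin (2 ^ (2 * M) * unitRoundoff p) xs ϱ` and its assertions `TransformPhiSpec`
(Theorem 3.2 / Lemma 3.4), the code (3.7) `↦ accSumOffset`, `fl(Σ pᵢ)` (recursive) `↦ flSum fl`, `FastTwoSum ↦
BoldoJeannerodMelquiondMuller2023.fast2Sum fl`, `[res, R, p′] = TransformK(p, ϱ) ↦ transformK fl p emin xs ϱ` —
continue).
* `pred`, `succ` as FUNCTIONS (Algorithms 7.1, 7.4; Remark 4: "they may computed in rounding to nearest using
  Algorithm 3.5 (`NextPowerTwo`) from Part I of this paper, or by the algorithms presented in [23]") ↦ parameters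
  `pred succ : ℚ → ℚ` with the hypotheses `∀ f ∈ F, IsPred p emin f (pred f)` / `IsSucc p emin f (succ f)`; in
  Lemma 7.3 and in the core lemma `nearSumAux_spec` a neighbour is any `g` with `IsPred p emin res g ∨
  IsSucc p emin res g`.
* ALGORITHM 7.1 `resD = DownSum(p)` ↦ `downSum fl pred p emin xs` (`[res, R, p′] = TransformK(p, 0)`,
  `δ = TransformK(p′, R)₁`, `if δ < 0, pred(res), else res`); "its counterpart" `resU = UpSum(p)` ↦
  `upSum fl succ p emin xs` (`if δ > 0, succ(res), else res`); `resD = max{f ∈ F : f ≤ s}` ↦ the three clauses of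
  `downSum_spec` (`resD ∈ F`, `resD ≤ s`, every `f ∈ F` with `f ≤ s` is `≤ resD`), dually `upSum_spec`.
* (7.1) `M⁻(c) ↦ (c⁻ + c) / 2`, `M⁺(c) ↦ (c + c⁺) / 2` for `IsPred p emin c c⁻`, `IsSucc p emin c c⁺` (written
  out; no separate definition).
* The code (7.3) `[res, δ₁]` ↦ `resDelta fl p emin xs : ℚ × ℚ` (`= FastTwoSum(τ₁, τ₂′)` on `[τ₁, τ₂, p′] =
  Transform(p, 0)`, `τ₂′ = fl(τ₂ + fl(Σ p′ᵢ))`); "`res` computed in (7.3) is the same as in (3.7) for `ϱ = 0`"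
  (`= TransformK(p, 0)₁ = AccSum(p)` of Algorithm 4.1) ↦ `resDelta_fst`.
* Lemma 7.3's `δres ∈ {½(pred(res) − res), ½(succ(res) − res)}` ↦ `(g − res) / 2` for a neighbour `g` of
  `res = TransformK(p, 0)₁`; `σ′ = 2^(M + ⌈log₂ μ′⌉)`, `epsσ′ ↦ unitRoundoff p * 2 ^ (M + Int.clog 2 (maxAbs p′))`,
  exactly the grid of (6.2) in `transformK_spec`.
* ALGORITHM 7.4 `resN = NearSum(p)` ↦ `nearSum fl pred succ p emin xs`, assembled from `resDelta` (lines 1–3),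
  `transformK fl p emin xs 0` (lines 1–3 and 6: `R = fl(τ₂ − fl(res − τ₁)) = TransformK(p, 0)₂`,
  `p′ = TransformK(p, 0)₃`), and the two blocks `nearSumLo fl pred …` (`if δ < 0 …`) / `nearSumHi fl succ …`
  ("the case `δ > 0` is treated similarly", written out with the mirrored tests), whose lines
  `γ = fl(g − res)`, `δ′ = fl(γ/2)`, `δ″ = TransformK(p′, fl(R − δ′))₁` are `nearSumAux fl p emin p′ res R g =
  (δ′, δ″)`. Every arithmetic operation of the listing is executed through `fl` (and proved exact where Remark 1
  says so); the comparisons `δ = 0`, `δ < 0`, `γ = −eta`, `δ″ > 0`, … are exact comparisons of floating-point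
  numbers; `resN = fl(res + δ′)` is the one genuine rounding.

Typed and PROVED (all sorry-free; `[cite: …]` locators on every declaration):

* Part I §2 facts on `pred`/`succ` used by §7 (symmetry, exact gaps): `isSucc_of_isPred`, `isPred_of_isSucc`,
  `isPred_neg_iff`, `isSucc_neg_iff`, `le_abs_of_isPred_or_isSucc`, `isSucc_add_two_u_ufp` / `isPred_sub_two_u_ufp`
  ((2.4): the neighbours of `f ∉ U` at distance `2eps·ufp(f)`), `isPred_two_zpow` (`pred(2ᴱ) = 2ᴱ − eps2ᴱ`),
  `exists_sub_pred_eq_two_zpow` / `exists_succ_sub_eq_two_zpow` (the gap to a neighbour is a power of two `≥ eta`),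
  `isFloat_pred_sub` / `isFloat_succ_sub` ("`γ = pred(res) − res` is always in `F`"), `isFloat_half_pred_sub` /
  `isFloat_half_succ_sub` (`γ ≠ ∓eta ⟹ γ/2 ∈ F`), `half_gap_facts` (`δres ∈ F ⟹ res ∉ U` and (7.6)
  `|δres| ≤ eps·ufp(res)`).
* (7.1)/(7.2) — `fl_le_of_lt_mid_succ` (`s < M⁺(c) ⟹ fl(s) ≤ c`, in particular `fl(s) ≠ succ(c)`),
  `le_fl_of_mid_pred_lt` (`M⁻(c) < s ⟹ c ≤ fl(s)`), `fl_eq_of_mid_pred_lt_of_lt_mid_succ` (`M⁻(c) < s < M⁺(c) ⟹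
  fl(s) = c`), `fl_eq_pred_of_lt_mid_pred`, `fl_eq_succ_of_mid_succ_lt` (for `c ∈ □(s)`), `fl_eq_or_isPred_or_isSucc`
  ("if `res` is a faithful rounding of `s` and `res ≠ s`, then `res` must be one of the immediate floating-point
  neighbors": `fl(s) ∈ {pred(res), res, succ(res)}`).
* ALGORITHM 7.1 — `downSum`, `upSum`, `transformK_transformK_spec` (the two calls: `res ∈ □(s)`, (6.1),
  `δ ∈ □(s − res)`, hence `sign(δ) = sign(s − res)` and `δ = 0 ⟹ s = res`), `downSum_spec` (`resD ∈ F`,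
  `resD ≤ s`, and every `f ∈ F` with `f ≤ s` is `≤ resD`), `upSum_spec`, `downSum_eq_upSum_iff` ("`resD = resU`
  is equivalent to `s ∈ F`").
* The loop bound behind Lemma 7.3's last case — `transformPhiAux_abs_fst_le`, `abs_transformPhi_fst_le`: for
  `Transform(p, 0)` with `Φ = 2^(2M)eps`, `|τ₁| ≤ (2ᴹ + 1)σ` (source: `|τ₁| < (1 + eps)(2ᴹ + 1)σ`; NOTE (b));
  `abs_sum_le_length_mul` (`|Σ p′ᵢ| ≤ n·max|p′ᵢ|`-type bound).
* LEMMA 7.2 — `resDelta`, `resDelta_fst`, `resDelta_spec` (`res ∈ □(s)`, `res + δ₁ = τ₁ + τ₂′` exactly, and the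
  one-sided conclusions `δ₁ ≤ 0 ⟹ fl(s) ≤ res`, `0 ≤ δ₁ ⟹ res ≤ fl(s)`), `fl_sum_mem_of_resDelta` (as printed:
  `fl(s) ∈ {pred(res), res, succ(res)}`, `δ₁ = 0 ⟹ fl(s) = res`, and (7.4)).
* LEMMA 7.3 — `onGrid_half_sub`, `isFloat_of_onGrid_of_onGrid_eta` ((2.10), extended below `emin` by the
  `eta`-grid), `transformK_sub_half_gap_spec`: for `[res, R, p′] = TransformK(p, 0)`, a neighbour `g` of `res` and
  `δres = ½(g − res) ∈ F`: `R − δres ∈ F`, and `p′ ≠ 0 ⟹ δres ∈ epsσ′ℤ`.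
* ALGORITHM 7.4 / THEOREM 7.5 / REMARK 1 — `nearSumAux`, `nearSumLo`, `nearSumHi`, `nearSum`; `nearSumAux_spec`
  (Remark 1: `fl(g − res) = g − res`, `fl(γ/2) = γ/2`, `fl(R − δ′) = R − δ′`; and `δ″ ∈ □(s − µ)`, `δ″ = 0 ⟹ s = µ`
  for `µ = res + δ′`), `nearSumLo_eq_fl_sum`, `nearSumHi_eq_fl_sum` (the two branches), `nearSum_eq_fl_sum`
  (THEOREM 7.5: `NearSum(p) = fl(Σ pᵢ)`), `nearSum_faithful` (corollary: `NearSum(p) ∈ □(s)`, and `= s` if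
  `s ∈ F`). The other two exact operations of Remark 1, `Δ = fl(res − τ₁) = res − τ₁` and `R = fl(τ₂ − Δ) =
  τ₂ − Δ`, are (6.3) (`AccSumK.transformK_spec`).

NOTES. (a) STATEMENTS. All results are stated for EVERY input vector (the zero vector included: there
`TransformK(p, 0) = [0, 0, p]`, `δ₁ = 0`, and `NearSum`, `DownSum`, `UpSum` return `0 = s`; in Lemma 7.3 the
hypothesis `δres ∈ F` excludes it, as it excludes every `res ∈ U`). Theorem 7.5 is proved for the rounding `fl`
that the algorithm itself executes — any rounding to nearest in the sense of `IsRoundNearest` (an arbitrary, even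
argument-dependent, tie rule); "in the sense of IEEE 754" is the special case of ties-to-even. `pred`/`succ` enter
as correct oracles (Remark 4); (7.1) is used unfolded. Lemma 7.2 is typed twice: as printed
(`fl_sum_mem_of_resDelta`) and in the one-sided form its printed proof establishes and the proof of Theorem 7.5
uses (`resDelta_spec`: `δ₁ ≤ 0 ⟹ s < M⁺(res) ⟹ fl(s) ≤ res`, `0 ≤ δ₁ ⟹ res ≤ fl(s)`).
(b) THE PROOF OF LEMMA 7.3 is organised around one mechanism, with the source's ingredients ((3.11), (3.14),
(3.16), (6.1), (7.5)/(7.6), (2.10), `t⁽⁰⁾ = 0`): if `2ᵉ < |res|` then `res, g ∈ 2eps2ᵉℤ` by (2.4)/(2.8), so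
`δres ∈ eps2ᵉℤ` (this is (7.5)); if moreover `t + τ ∈ eps2ᵉℤ` (`t = t⁽ᵐ⁻¹⁾`, `τ = τ⁽ᵐ⁾`, `τ₁ + τ₂ = t + τ`) then
`R − δres = t + τ − res − δres ∈ eps2ᵉℤ ∩ etaℤ`, and `|R − δres| ≤ 2ᵉ` gives `R − δres ∈ F` by (2.10) (or by the
`eta`-grid when `eps2ᵉ < eta`). The bound on `|R − δres|` comes from (6.1): `|R| ≤ |s − res| + |Σ p′ᵢ| <
2eps·ufp(res) + (2ᴹ − 2)epsσ`. The cases are cut by `|res|` rather than by `|τ₁|`: `σ ≤ ½eps⁻¹eta` (as printed: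
`p′ = 0`, `res = τ₁`, `R = τ₂`; the "`m > 1`" step is replaced by the loop bound below, which also covers `m = 1`:
`|res| < 2ᴹeps⁻¹eta`); `|res| > σ = 2ᵏ` (grid `epsσ`, `e = k`; as in the source this needs `t⁽⁰⁾ = ϱ = 0` through
`|τ₁| ≤ (2ᴹ + 1)σ`, whence `|s| ≤ (2ᴹ + 2)σ ∈ F`, `|res| ≤ (2ᴹ + 2)σ` and `ufp(res) ≤ 2ᴹσ`); `½σ < |res| ≤ σ`
(grid `½epsσ`, `e = k − 1`); `|res| ≤ ½σ` (then `|τ₁| ≤ ⅘σ < σ` by (3.16), so `τ₂ = 0` as in the printed first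
case; grid `½eps·ufp(res)`, `e = log₂ ufp(res) − 1`, via `|s| ≤ 3ufp(τ₁) ∈ F`, `ufp(res) ≤ 2ufp(τ₁) ≤ 4ufp(res)` and
`2^(2M)epsσ ≤ ufp(τ₁)`). The loop bound `abs_transformPhi_fst_le` is proved as `|τ₁| ≤ (2ᴹ + 1)σ` (induction over
the passes of `Transform(p, 0)`: `|t⁽ᵐ⁾| ≤ (2ᴹ + 1)σₘ` from `|t⁽ᵐ⁻¹⁾| < 2^(2M)epsσₘ₋₁ = 2ᴹσₘ`, `|τ⁽ᵐ⁾| < σₘ`, and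
`(2ᴹ + 1)σₘ ∈ F` bounding the nearest rounding), which is all the printed `(1 + eps)(2ᴹ + 1)σ` is used for. The
"Moreover" part (`δres ∈ epsσ′ℤ`) is `δres ∈ ½eps·ufp(res)ℤ` plus `M + ⌈log₂ μ′⌉ ≤ k + M − p ≤ log₂ ufp(res) − 1`
((3.8) `μ′ ≤ epsσ`, (3.11), (3.16), `M ≥ 2`), as printed.
(c) THEOREM 7.5, the case `δ″ = 0`: "then `s = M⁻(res)`" is obtained from Lemma 6.3's clause "if `res = 0` then
`res = s + ϱ` exactly" applied to `TransformK(p′, R − δ′)` (a faithful rounding that is `0` is exact), not from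
faithfulness alone. The case `γ = −eta`: `pred(res) = res − eta < s` (`res ∈ □(s)`) and `s − res ∈ etaℤ` give
`res ≤ s`, hence `res ≤ fl(s)`, and `fl(s) ≤ res` by (7.4): `resN = res = fl(s)` (dually for `γ = eta`).
(d) CONVENTIONS. `fl(Σ p′ᵢ)` is recursive summation `flSum` as in `AccSign`/`AccSumK`; statements about the
components of `TransformK(p, 0)` and of (7.3) are written with the explicit terms (no `let`), the proofs introduce
the names `res, R, p′, τ₁, τ₂, σ`. Not typed: Remark 2 (the flop count `(4m + 4m′ + 4)n + O(m + m′)` and the advice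
to test `δ = 0`), Remark 3 (overflow "is easily treated by some scaling"), the `pred`/`succ` algorithms of Remark 4,
the computing-time discussion (`t_N/t_f` "can be arbitrarily large") and the K-fold rounded-to-nearest variant
sketched at the end of §7 (no algorithm is printed); §8 (`AccSumHuge`) is left to a later file.
-/

namespace Literature.ComputerArithmetic.RumpOgitaOishi2009

open Literature.ComputerArithmetic.JeannerodRump2018
open Literature.ComputerArithmetic.JeannerodRump2018.SumTree
open Literature.ComputerArithmetic.BoldoJeannerodMelquiondMuller2023
open Literature.ComputerArithmetic.JoldesMullerPopescu2017 (isFloat_two_zpow two_zpow_emin_le_abs)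
open Literature.ComputerArithmetic.LangeRump2018 (abs_list_sum_le exact_eq_leaves_sum)
open Literature.ComputerArithmetic.RumpOgitaOishi2008

variable {p : ℕ} {emin : ℤ} {fl : ℚ → ℚ}

/-! ### Predecessor and successor: the facts of Part I §2 used in §7 -/

/-- `pred(c) < c` are neighbours: `c = succ(pred(c))`. [cite: RumpOgitaOishi2009, §7 eq. (7.1) (pred, succ;
Part I §2 p. 195)] -/
theorem isSucc_of_isPred {f g : ℚ} (h : IsPred p emin f g) (hf : IsFloat p emin f) : IsSucc p emin g f :=
  ⟨hf, h.2.1, fun k hk hgk => not_lt.mp fun hkf => absurd (h.2.2 k hk hkf) (not_le.mpr hgk)⟩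

/-- `c < succ(c)` are neighbours: `c = pred(succ(c))`. [cite: RumpOgitaOishi2009, §7 eq. (7.1) (pred, succ;
Part I §2 p. 195)] -/
theorem isPred_of_isSucc {f g : ℚ} (h : IsSucc p emin f g) (hf : IsFloat p emin f) : IsPred p emin g f :=
  ⟨hf, h.2.1, fun k hk hkg => not_lt.mp fun hfk => absurd (h.2.2 k hk hfk) (not_le.mpr hkg)⟩

/-- Symmetry of `F`: `pred(−f) = −succ(f)`. [cite: RumpOgitaOishi2009, §7 (pred, succ; Part I §2 p. 195)] -/
theorem isPred_neg_iff {f g : ℚ} : IsPred p emin (-f) (-g) ↔ IsSucc p emin f g := by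
  constructor
  · rintro ⟨hg, hlt, hmax⟩
    refine ⟨by simpa using hg.neg, by linarith, fun h hh hfh => ?_⟩
    have := hmax (-h) hh.neg (by linarith)
    linarith
  · rintro ⟨hg, hlt, hmin⟩
    refine ⟨hg.neg, by linarith, fun h hh hhf => ?_⟩
    have := hmin (-h) hh.neg (by linarith)
    linarith

/-- Symmetry of `F`: `succ(−f) = −pred(f)`. [cite: RumpOgitaOishi2009, §7 (pred, succ; Part I §2 p. 195)] -/
theorem isSucc_neg_iff {f g : ℚ} : IsSucc p emin (-f) (-g) ↔ IsPred p emin f g := by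
  rw [← isPred_neg_iff, neg_neg, neg_neg]

/-- A neighbour of `f` is at least as large in magnitude as any float `0 ≤ c < |f|`.
[cite: RumpOgitaOishi2009, Lemma 7.3 (proof, eq. (7.5): the grid of `pred(res)`, `succ(res)`)] -/
theorem le_abs_of_isPred_or_isSucc {f g c : ℚ} (h : IsPred p emin f g ∨ IsSucc p emin f g)
    (hc : IsFloat p emin c) (hcf : c < |f|) : c ≤ |g| := by
  rcases lt_or_ge 0 f with hf0 | hf0
  · rw [abs_of_pos hf0] at hcf
    rcases h with h | h
    · exact (h.2.2 c hc hcf).trans (le_abs_self g)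
    · exact (hcf.trans h.2.1).le.trans (le_abs_self g)
  · have hf' : f < -c := by rw [abs_of_nonpos hf0] at hcf; linarith
    rcases h with h | h
    · have := h.2.1
      exact (show c ≤ -g by linarith).trans (neg_le_abs g)
    · have := h.2.2 (-c) hc.neg hf'
      exact (show c ≤ -g by linarith).trans (neg_le_abs g)

/-- The successor of a positive `f ∈ F`, `f ≥ ½eps⁻¹eta`, is `f + 2eps·ufp(f)` (Part I, Lemma 2.2 / (2.15)).
[cite: RumpOgitaOishi2009, Lemma 7.3 (proof, eqs. (7.5)–(7.6); Part I Lemma 2.2)] -/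
theorem isSucc_add_two_u_ufp (hp : 1 ≤ p) {f : ℚ} (hf : IsFloat p emin f) (hf0 : 0 < f)
    (hU : (2 : ℚ) ^ (emin + p - 1) ≤ f) : IsSucc p emin f (f + 2 * unitRoundoff p * ufp f) := by
  set E : ℤ := Int.log 2 |f| with hE
  have hfne : f ≠ 0 := hf0.ne'
  have hA : ufp f = (2 : ℚ) ^ E := ufp_of_ne_zero hfne
  have hEle : (2 : ℚ) ^ E ≤ |f| := by rw [← hA]; exact ufp_le_abs f
  have hgap : 2 * unitRoundoff p * ufp f = (2 : ℚ) ^ (E - p + 1) := by rw [hA, two_mul_u_mul_two_zpow]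
  have hFg : IsFloat p emin (f + 2 * unitRoundoff p * ufp f) := by
    have := isFloat_add_two_u_ufp_of_threshold_le hp hf (by rwa [abs_of_pos hf0]) 1 (by norm_num)
    simpa using this
  refine ⟨hFg, by rw [hgap]; linarith [two_zpow_pos (E - p + 1)], fun h hh hfh => ?_⟩
  have hhE : (2 : ℚ) ^ E ≤ |h| := by
    rw [abs_of_pos hf0] at hEle
    rw [abs_of_pos (hf0.trans hfh)]
    exact hEle.trans hfh.le
  have hgrid : OnGrid ((2 : ℚ) ^ (E - p + 1)) (h - f) :=
    (onGrid_of_isFloat_of_le_abs hh hhE).sub (onGrid_of_isFloat_of_le_abs hf hEle)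
  have := two_zpow_le_abs_of_onGrid hgrid (sub_ne_zero.mpr hfh.ne')
  rw [abs_of_pos (sub_pos.mpr hfh)] at this
  rw [hgap]
  linarith

/-- The predecessor of a positive `f ∈ F`, `f ≥ ½eps⁻¹eta`, which is not a power of two is
`f − 2eps·ufp(f)`. [cite: RumpOgitaOishi2009, Lemma 7.3 (proof, eqs. (7.5)–(7.6); Part I Lemma 2.2)] -/
theorem isPred_sub_two_u_ufp (hp : 1 ≤ p) {f : ℚ} (hf : IsFloat p emin f) (hf0 : 0 < f)
    (hU : (2 : ℚ) ^ (emin + p - 1) ≤ f) (hne : ufp f ≠ f) :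
    IsPred p emin f (f - 2 * unitRoundoff p * ufp f) := by
  set E : ℤ := Int.log 2 |f| with hE
  have hfne : f ≠ 0 := hf0.ne'
  have hA : ufp f = (2 : ℚ) ^ E := ufp_of_ne_zero hfne
  have hEle : (2 : ℚ) ^ E ≤ |f| := by rw [← hA]; exact ufp_le_abs f
  have hElt : (2 : ℚ) ^ E < f := by
    have h1 : (2 : ℚ) ^ E ≤ f := by rwa [abs_of_pos hf0] at hEle
    exact lt_of_le_of_ne h1 (by rwa [hA] at hne)
  have hgap : 2 * unitRoundoff p * ufp f = (2 : ℚ) ^ (E - p + 1) := by rw [hA, two_mul_u_mul_two_zpow]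
  have hFg : IsFloat p emin (f - 2 * unitRoundoff p * ufp f) := by
    have := isFloat_add_two_u_ufp_of_threshold_le hp hf (by rwa [abs_of_pos hf0]) (-1) (by norm_num)
    convert this using 1
    push_cast
    ring
  refine ⟨hFg, by rw [hgap]; linarith [two_zpow_pos (E - p + 1)], fun h hh hhf => ?_⟩
  have hfg : OnGrid ((2 : ℚ) ^ (E - p + 1)) f := onGrid_of_isFloat_of_le_abs hf hEle
  have h2E : OnGrid ((2 : ℚ) ^ (E - p + 1)) ((2 : ℚ) ^ E) := (onGrid_self ((2 : ℚ) ^ E)).of_le (by omega)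
  have hge : (2 : ℚ) ^ E + (2 : ℚ) ^ (E - p + 1) ≤ f := by
    have := two_zpow_le_abs_of_onGrid (hfg.sub h2E) (sub_ne_zero.mpr hElt.ne')
    rw [abs_of_pos (sub_pos.mpr hElt)] at this
    linarith
  by_cases hhE : h < (2 : ℚ) ^ E
  · rw [hgap]; linarith
  · have hhE' : (2 : ℚ) ^ E ≤ |h| := (not_lt.mp hhE).trans (le_abs_self h)
    have hgrid : OnGrid ((2 : ℚ) ^ (E - p + 1)) (f - h) := hfg.sub (onGrid_of_isFloat_of_le_abs hh hhE')
    have := two_zpow_le_abs_of_onGrid hgrid (sub_ne_zero.mpr hhf.ne')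
    rw [abs_of_pos (sub_pos.mpr hhf)] at this
    rw [hgap]
    linarith

/-- The predecessor of a power of two `2^E`, `E ≥ emin + p` (above the gradual-underflow range `U`), is
`2^E − eps·2^E = (1 − eps)2^E`. [cite: RumpOgitaOishi2009, Lemma 7.3 (proof, eq. (7.5), the case
`|res| = ufp(res)`; Part I Lemma 2.2)] -/
theorem isPred_two_zpow (hp : 1 ≤ p) {E : ℤ} (hE : emin + p ≤ E) :
    IsPred p emin ((2 : ℚ) ^ E) ((2 : ℚ) ^ E - (2 : ℚ) ^ (E - p)) := by
  have h2 : (2 : ℚ) ≠ 0 := by norm_num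
  have hsplit : (2 : ℚ) ^ E = 2 ^ p * (2 : ℚ) ^ (E - p) := by
    rw [← zpow_natCast, ← zpow_add₀ h2]; congr 1; ring
  have hg : (2 : ℚ) ^ E - (2 : ℚ) ^ (E - p) = ((2 ^ p - 1 : ℤ) : ℚ) * (2 : ℚ) ^ (E - p) := by
    rw [hsplit]; push_cast; ring
  have hFg : IsFloat p emin ((2 : ℚ) ^ E - (2 : ℚ) ^ (E - p)) := by
    rw [hg]
    refine isFloat_of_abs_le hp ?_ (by omega)
    rw [abs_of_nonneg (by
      have : (1 : ℤ) ≤ 2 ^ p := one_le_pow₀ (by norm_num)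
      omega)]
    omega
  have hpos : (0 : ℚ) < (2 : ℚ) ^ (E - p) := two_zpow_pos _
  refine ⟨hFg, by linarith, fun h hh hhf => ?_⟩
  have hhalf : (2 : ℚ) ^ (E - p) ≤ (2 : ℚ) ^ (E - 1) := zpow_le_zpow_right₀ (by norm_num) (by omega)
  have hE1 : (2 : ℚ) ^ E = 2 * (2 : ℚ) ^ (E - 1) := by
    rw [mul_comm, ← zpow_add_one₀ h2]; congr 1; ring
  by_cases hhE : h < (2 : ℚ) ^ (E - 1)
  · linarith
  · have hhE' : (2 : ℚ) ^ (E - 1) ≤ |h| := (not_lt.mp hhE).trans (le_abs_self h)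
    have hhg : OnGrid ((2 : ℚ) ^ (E - p)) h := by
      have := onGrid_of_isFloat_of_le_abs hh hhE'
      rwa [show E - 1 - (p : ℤ) + 1 = E - p by ring] at this
    have hfg : OnGrid ((2 : ℚ) ^ (E - p)) ((2 : ℚ) ^ E) := (onGrid_self ((2 : ℚ) ^ E)).of_le (by omega)
    have := two_zpow_le_abs_of_onGrid (hfg.sub hhg) (sub_ne_zero.mpr hhf.ne')
    rw [abs_of_pos (sub_pos.mpr hhf)] at this
    linarith

/-- The gap to the predecessor is a power of two `≥ eta`: `c − pred(c) = 2ʲ`, `j ≥ emin` — namely `eta` in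
the underflow range `U`, `2eps·ufp(c)`, or `eps·ufp(c)` when `|c| = ufp(c)` is a power of two above `U`, cf.
(7.5). [cite: RumpOgitaOishi2009, Lemma 7.3 (proof, eq. (7.5)); Part I Lemma 2.2] -/
theorem exists_sub_pred_eq_two_zpow (hp : 1 ≤ p) {f g : ℚ} (hf : IsFloat p emin f) (hg : IsPred p emin f g) :
    ∃ j : ℤ, emin ≤ j ∧ f - g = (2 : ℚ) ^ j := by
  by_cases hU : |f| ≤ (2 : ℚ) ^ (emin + p - 1)
  · have := (isPred_sub_eta_and_isSucc_add_eta hp hf hU).1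
    exact ⟨emin, le_rfl, by rw [hg.unique this]; ring⟩
  · push Not at hU
    have hf0 : f ≠ 0 := by
      rintro rfl
      rw [abs_zero] at hU
      exact absurd hU (not_lt.mpr (two_zpow_pos _).le)
    set E : ℤ := Int.log 2 |f| with hE
    have hA : ufp f = (2 : ℚ) ^ E := ufp_of_ne_zero hf0
    have hEle : (2 : ℚ) ^ E ≤ |f| := by rw [← hA]; exact ufp_le_abs f
    have hElt : |f| < 2 * (2 : ℚ) ^ E := by rw [← hA]; exact abs_lt_two_mul_ufp hf0
    have hEge : emin + p - 1 ≤ E := by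
      by_contra hlt
      push Not at hlt
      have : (2 : ℚ) ^ (E + 1) ≤ (2 : ℚ) ^ (emin + p - 1) := zpow_le_zpow_right₀ (by norm_num) (by omega)
      rw [zpow_add_one₀ (by norm_num : (2 : ℚ) ≠ 0)] at this
      linarith
    rcases lt_or_gt_of_ne hf0 with hneg | hpos
    · -- `f < 0`: `pred(f) = −succ(−f) = −(−f + 2eps·ufp(f))`
      have hS := isSucc_add_two_u_ufp hp hf.neg (neg_pos.mpr hneg)
        (by rw [abs_of_neg hneg] at hU; exact hU.le)
      rw [ufp_neg] at hS
      have hP : IsPred p emin f (-(-f + 2 * unitRoundoff p * ufp f)) := by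
        have := (isPred_neg_iff (p := p) (emin := emin) (f := -f)
          (g := -f + 2 * unitRoundoff p * ufp f)).mpr hS
        rwa [neg_neg] at this
      refine ⟨E - p + 1, by omega, ?_⟩
      rw [hg.unique hP, hA, two_mul_u_mul_two_zpow]
      ring
    · rw [abs_of_pos hpos] at hU
      by_cases hfE : ufp f = f
      · -- `f = 2^E` is a power of two, necessarily `E ≥ emin + p`
        rw [hA] at hfE
        have hEge' : emin + p ≤ E := by
          by_contra hlt
          push Not at hlt
          have : (2 : ℚ) ^ E ≤ (2 : ℚ) ^ (emin + p - 1) := zpow_le_zpow_right₀ (by norm_num) (by omega)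
          linarith
        have hP := isPred_two_zpow (emin := emin) hp hEge'
        rw [hfE] at hP
        exact ⟨E - p, by omega, by rw [hg.unique hP]; ring⟩
      · have hP := isPred_sub_two_u_ufp hp hf hpos hU.le hfE
        refine ⟨E - p + 1, by omega, ?_⟩
        rw [hg.unique hP, hA, two_mul_u_mul_two_zpow]
        ring

/-- The gap to the successor is a power of two `≥ eta`: `succ(c) − c = 2ʲ`, `j ≥ emin`, cf. (7.5).
[cite: RumpOgitaOishi2009, Lemma 7.3 (proof, eq. (7.5)); Part I Lemma 2.2] -/
theorem exists_succ_sub_eq_two_zpow (hp : 1 ≤ p) {f g : ℚ} (hf : IsFloat p emin f)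
    (hg : IsSucc p emin f g) : ∃ j : ℤ, emin ≤ j ∧ g - f = (2 : ℚ) ^ j := by
  obtain ⟨j, hj, h⟩ := exists_sub_pred_eq_two_zpow hp hf.neg (isPred_neg_iff.mpr hg)
  exact ⟨j, hj, by linarith⟩

/-- "The quantity `γ = pred(res) − res` is always in `F`." [cite: RumpOgitaOishi2009, Theorem 7.5 (proof)] -/
theorem isFloat_pred_sub (hp : 1 ≤ p) {f g : ℚ} (hf : IsFloat p emin f) (hg : IsPred p emin f g) :
    IsFloat p emin (g - f) := by
  obtain ⟨j, hj, h⟩ := exists_sub_pred_eq_two_zpow hp hf hg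
  rw [show g - f = -(2 : ℚ) ^ j by linarith]
  exact (isFloat_two_zpow hp hj).neg

/-- `succ(res) − res ∈ F` ("the case `δ > 0` is treated similarly"). [cite: RumpOgitaOishi2009, Theorem 7.5
(proof)] -/
theorem isFloat_succ_sub (hp : 1 ≤ p) {f g : ℚ} (hf : IsFloat p emin f) (hg : IsSucc p emin f g) :
    IsFloat p emin (g - f) := by
  obtain ⟨j, hj, h⟩ := exists_succ_sub_eq_two_zpow hp hf hg
  rw [h]
  exact isFloat_two_zpow hp hj

/-- "If `γ ≠ −eta`, then `δ′ = ½(pred(res) − res) ∈ F`." [cite: RumpOgitaOishi2009, Theorem 7.5 (proof)] -/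
theorem isFloat_half_pred_sub (hp : 1 ≤ p) {f g : ℚ} (hf : IsFloat p emin f) (hg : IsPred p emin f g)
    (hne : g - f ≠ -(2 : ℚ) ^ emin) : IsFloat p emin ((g - f) / 2) := by
  obtain ⟨j, hj, h⟩ := exists_sub_pred_eq_two_zpow hp hf hg
  have hj' : emin + 1 ≤ j := by
    by_contra hlt
    have hjeq : j = emin := by omega
    exact hne (by rw [hjeq] at h; linarith)
  rw [show (g - f) / 2 = -(2 : ℚ) ^ (j - 1) by
    rw [zpow_sub_one₀ (by norm_num : (2 : ℚ) ≠ 0), ← h]; ring]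
  exact (isFloat_two_zpow hp (by omega)).neg

/-- If `succ(res) − res ≠ eta` then `½(succ(res) − res) ∈ F` ("the case `δ > 0` is treated similarly").
[cite: RumpOgitaOishi2009, Theorem 7.5 (proof)] -/
theorem isFloat_half_succ_sub (hp : 1 ≤ p) {f g : ℚ} (hf : IsFloat p emin f) (hg : IsSucc p emin f g)
    (hne : g - f ≠ (2 : ℚ) ^ emin) : IsFloat p emin ((g - f) / 2) := by
  obtain ⟨j, hj, h⟩ := exists_succ_sub_eq_two_zpow hp hf hg
  have hj' : emin + 1 ≤ j := by
    by_contra hlt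
    have hjeq : j = emin := by omega
    exact hne (by rw [hjeq] at h; exact h)
  rw [show (g - f) / 2 = (2 : ℚ) ^ (j - 1) by
    rw [zpow_sub_one₀ (by norm_num : (2 : ℚ) ≠ 0), ← h]; ring]
  exact isFloat_two_zpow hp (by omega)

/-- "The assumption `δres ∈ F` implies `|res| ≥ eps⁻¹eta`" (here: `res ∉ U`, i.e. `|res| > ½eps⁻¹eta` — in
`U` the half gap is `eta/2 ∉ F`) and (7.6) `|δres| ≤ eps·ufp(res)`, for `δres = ½(g − res)`, `g` a neighbour
of `res`. [cite: RumpOgitaOishi2009, Lemma 7.3 (proof, eqs. (7.5)–(7.6))] -/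
theorem half_gap_facts (hp : 1 ≤ p) {f g : ℚ} (hf : IsFloat p emin f) (h : IsPred p emin f g ∨ IsSucc p emin f g)
    (hδ : IsFloat p emin ((g - f) / 2)) :
    (2 : ℚ) ^ (emin + p - 1) < |f| ∧ |(g - f) / 2| ≤ unitRoundoff p * ufp f := by
  have h2 : (2 : ℚ) ≠ 0 := by norm_num
  have key : (2 : ℚ) ^ (emin + p - 1) < |f| := by
    by_contra hU
    push Not at hU
    obtain ⟨hP, hS⟩ := isPred_sub_eta_and_isSucc_add_eta hp hf hU
    have habs : |(g - f) / 2| = (2 : ℚ) ^ (emin - 1) := by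
      rcases h with h | h
      · rw [h.unique hP, show (f - (2 : ℚ) ^ emin - f) / 2 = -(2 : ℚ) ^ (emin - 1) by
          rw [zpow_sub_one₀ h2]; ring, abs_neg, abs_of_pos (two_zpow_pos _)]
      · rw [h.unique hS, show (f + (2 : ℚ) ^ emin - f) / 2 = (2 : ℚ) ^ (emin - 1) by
          rw [zpow_sub_one₀ h2]; ring, abs_of_pos (two_zpow_pos _)]
    have h0 := eq_zero_of_isFloat_of_abs_lt hδ
      (by rw [habs]; exact zpow_lt_zpow_right₀ (by norm_num) (by omega))
    rw [h0, abs_zero] at habs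
    exact absurd habs (two_zpow_pos _).ne
  refine ⟨key, ?_⟩
  obtain ⟨g₁, hg₁⟩ := exists_isPred hp hf
  obtain ⟨g₂, hg₂⟩ := exists_isSucc hp hf
  obtain ⟨h1, -, h3⟩ := pred_succ_within_two_u_ufp hp hf key hg₁ hg₂
  rcases h with h | h
  · have hlt := h.2.1
    have heq := h.unique hg₁
    rw [abs_of_nonpos (by linarith)]
    linarith
  · have hlt := h.2.1
    have heq := h.unique hg₂
    rw [abs_of_nonneg (by linarith)]
    linarith

/-! ### §7, eqs. (7.1)–(7.2): the switching points `M⁻(c) = ½(pred(c) + c)`, `M⁺(c) = ½(c + succ(c))` -/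

/-- (7.2), fourth clause: "`s < M⁺(res) ⇒ fl(s) ≠ succ(res)`", in the form `fl(s) ≤ res` valid for every
rounding to nearest (any tie rule): with `M⁺(c) := ½(c + succ(c))` (7.1).
[cite: RumpOgitaOishi2009, §7 eqs. (7.1)–(7.2)] -/
theorem fl_le_of_lt_mid_succ (hfl : IsRoundNearest p emin fl) {c c' s : ℚ} (hc : IsFloat p emin c)
    (hc' : IsSucc p emin c c') (hs : s < (c + c') / 2) : fl s ≤ c := by
  by_contra hlt
  push Not at hlt
  have hge : c' ≤ fl s := hc'.2.2 _ (hfl s).1 hlt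
  have hmin := (hfl s).2 c hc
  have h1 : |s - fl s| = fl s - s := by
    rw [abs_sub_comm]; exact abs_of_pos (by linarith [hc'.2.1])
  rcases le_or_gt c s with hcs | hcs
  · rw [h1, abs_of_nonneg (by linarith)] at hmin; linarith
  · rw [h1, abs_of_neg (by linarith)] at hmin; linarith

/-- (7.2), fifth clause: "`M⁻(res) < s ⇒ fl(s) ≠ pred(res)`", in the form `res ≤ fl(s)`, with
`M⁻(c) := ½(pred(c) + c)` (7.1). [cite: RumpOgitaOishi2009, §7 eqs. (7.1)–(7.2)] -/
theorem le_fl_of_mid_pred_lt (hfl : IsRoundNearest p emin fl) {c c' s : ℚ} (hc : IsFloat p emin c)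
    (hc' : IsPred p emin c c') (hs : (c' + c) / 2 < s) : c ≤ fl s := by
  by_contra hlt
  push Not at hlt
  have hle : fl s ≤ c' := hc'.2.2 _ (hfl s).1 hlt
  have hmin := (hfl s).2 c hc
  have h1 : |s - fl s| = s - fl s := abs_of_pos (by linarith [hc'.2.1])
  rcases le_or_gt s c with hcs | hcs
  · rw [h1, abs_of_nonpos (by linarith)] at hmin; linarith
  · rw [h1, abs_of_pos (by linarith)] at hmin; linarith

/-- (7.2), first clause: "`M⁻(res) < s < M⁺(res)` implies `fl(s) = res`".
[cite: RumpOgitaOishi2009, §7 eqs. (7.1)–(7.2)] -/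
theorem fl_eq_of_mid_pred_lt_of_lt_mid_succ (hfl : IsRoundNearest p emin fl) {c c₁ c₂ s : ℚ}
    (hc : IsFloat p emin c) (hc₁ : IsPred p emin c c₁) (hc₂ : IsSucc p emin c c₂) (h₁ : (c₁ + c) / 2 < s)
    (h₂ : s < (c + c₂) / 2) : fl s = c :=
  le_antisymm (fl_le_of_lt_mid_succ hfl hc hc₂ h₂) (le_fl_of_mid_pred_lt hfl hc hc₁ h₁)

/-- (7.2), second clause: for `res ∈ □(s)`, "`s < M⁻(res) ⇒ fl(s) = pred(res)`".
[cite: RumpOgitaOishi2009, §7 eqs. (7.1)–(7.2)] -/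
theorem fl_eq_pred_of_lt_mid_pred (hfl : IsRoundNearest p emin fl) {c c' s : ℚ}
    (hcs : IsFaithfulRounding p emin c s) (hc' : IsPred p emin c c') (hs : s < (c' + c) / 2) : fl s = c' := by
  have hlt : c' < s := hcs.2.1 c' hc'.1 hc'.2.1
  refine le_antisymm ?_ (le_fl_of_le hfl hc'.1 hlt.le)
  exact fl_le_of_lt_mid_succ hfl hc'.1 (isSucc_of_isPred hc' hcs.1) (by linarith)

/-- (7.2), third clause: for `res ∈ □(s)`, "`M⁺(res) < s ⇒ fl(s) = succ(res)`".
[cite: RumpOgitaOishi2009, §7 eqs. (7.1)–(7.2)] -/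
theorem fl_eq_succ_of_mid_succ_lt (hfl : IsRoundNearest p emin fl) {c c' s : ℚ}
    (hcs : IsFaithfulRounding p emin c s) (hc' : IsSucc p emin c c') (hs : (c + c') / 2 < s) : fl s = c' := by
  have hlt : s < c' := hcs.2.2 c' hc'.1 hc'.2.1
  refine le_antisymm (fl_le_of_le hfl hc'.1 hlt.le) ?_
  exact le_fl_of_mid_pred_lt hfl hc'.1 (isPred_of_isSucc hc' hcs.1) (by linarith)

/-- "If `res` is a faithful rounding of `s := Σ pᵢ` and `res ≠ s`, then `res` must be one of the immediate
floating-point neighbors of `s`": for `res ∈ □(s)`, `fl(s) ∈ {pred(res), res, succ(res)}`.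
[cite: RumpOgitaOishi2009, §7 (before eq. (7.1)); Lemma 7.2 (proof)] -/
theorem fl_eq_or_isPred_or_isSucc (hp : 1 ≤ p) (hfl : IsRoundNearest p emin fl) {c s : ℚ}
    (h : IsFaithfulRounding p emin c s) : fl s = c ∨ IsPred p emin c (fl s) ∨ IsSucc p emin c (fl s) := by
  obtain ⟨c₁, hc₁⟩ := exists_isPred hp h.1
  obtain ⟨c₂, hc₂⟩ := exists_isSucc hp h.1
  have hF := (hfl s).1
  rcases lt_trichotomy (fl s) c with hlt | heq | hgt
  · have h1 : fl s ≤ c₁ := hc₁.2.2 _ hF hlt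
    have h2 : c₁ ≤ fl s := le_fl_of_le hfl hc₁.1 (h.2.1 c₁ hc₁.1 hc₁.2.1).le
    rw [← le_antisymm h1 h2] at hc₁
    exact Or.inr (Or.inl hc₁)
  · exact Or.inl heq
  · have h1 : c₂ ≤ fl s := hc₂.2.2 _ hF hgt
    have h2 : fl s ≤ c₂ := fl_le_of_le hfl hc₂.1 (h.2.2 c₂ hc₂.1 hc₂.2.1).le
    rw [← le_antisymm h2 h1] at hc₂
    exact Or.inr (Or.inr hc₂)

/-! ### `Transform(p, 0)`: the bound `|τ₁| < (2ᴹ + 2)σ` from `t⁽⁰⁾ = ϱ = 0` (proof of Lemma 7.3) -/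

/-- The loop of `Transform` with `Φ = 2^(2M)eps`, started from `|t| ≤ 2ᴹσ` (in particular from `t⁽⁰⁾ = 0`):
every later pass is entered with `|t⁽ᵐ⁻¹⁾| < 2^(2M)epsσ_{m−2} = 2ᴹσ_{m−1}` (the failed "until"-condition), so the
results satisfy `|τ₁| = |fl(t⁽ᵐ⁻¹⁾ + τ⁽ᵐ⁾)| ≤ (2ᴹ + 1)σ` — the source's "(1 + eps)(2ᴹ + 1)σ < (2ᴹ + 2)σ",
sharpened by `(2ᴹ + 1)σ ∈ F`. [cite: RumpOgitaOishi2009, Lemma 7.3 (proof, the display after (7.8):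
`|τ₁| < (2ᴹ + 2)σ`)] -/
theorem transformPhiAux_abs_fst_le (hp : 1 ≤ p) (hfl : IsRoundNearest p emin fl) {M : ℕ} (hM : M < p)
    {n : ℕ} (hnM : n + 2 ≤ 2 ^ M) :
    ∀ (fuel : ℕ) (t : ℚ) (k : ℤ) (xs : List ℚ), emin ≤ k → xs.length = n →
      (∀ x ∈ xs, IsFloat p emin x ∧ |x| ≤ (2 : ℚ) ^ (k - M)) → IsFloat p emin t →
      |t| ≤ (2 : ℚ) ^ (k + M) →
      |(transformPhiAux fl M (unitRoundoff p) (2 ^ (2 * M) * unitRoundoff p) ((2 : ℚ) ^ (emin + p - 1)) fuel t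
          ((2 : ℚ) ^ k) xs).1| ≤
        (2 ^ M + 1) * (transformPhiAux fl M (unitRoundoff p) (2 ^ (2 * M) * unitRoundoff p)
          ((2 : ℚ) ^ (emin + p - 1)) fuel t ((2 : ℚ) ^ k) xs).2.2.2
  | 0, t, k, xs, _, _, _, _, ht => by
      show |t| ≤ (2 ^ M + 1) * (2 : ℚ) ^ k
      have h2k := two_zpow_pos k
      calc |t| ≤ (2 : ℚ) ^ (k + M) := ht
        _ = 2 ^ M * (2 : ℚ) ^ k := by
          rw [zpow_add₀ (by norm_num : (2 : ℚ) ≠ 0), zpow_natCast, mul_comm]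
        _ ≤ (2 ^ M + 1) * (2 : ℚ) ^ k := by nlinarith
  | fuel + 1, t, k, xs, hk, hlen, hxs, ht, htabs => by
      have hnlt : xs.length < 2 ^ M := by rw [hlen]; omega
      have hdiv : (2 : ℚ) ^ k / 2 ^ M = (2 : ℚ) ^ (k - M) := by
        rw [zpow_sub₀ (by norm_num : (2 : ℚ) ≠ 0), zpow_natCast]
      have hxs' : ∀ x ∈ xs, IsFloat p emin x ∧ |x| ≤ (2 : ℚ) ^ k / 2 ^ M := by
        intro x hx; rw [hdiv]; exact hxs x hx
      obtain ⟨-, hlo, hτabs, hnσ, -, -, hτF⟩ := extractVector_eft hp hfl hk hM hxs' hnlt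
      have hτlt : |(extractVector fl ((2 : ℚ) ^ k) xs).1| < (2 : ℚ) ^ k := hτabs.trans_lt hnσ
      simp only [transformPhiAux]
      set τ : ℚ := (extractVector fl ((2 : ℚ) ^ k) xs).1 with hτdef
      set xs₁ : List ℚ := (extractVector fl ((2 : ℚ) ^ k) xs).2 with hxs₁def
      have hlen₁ : xs₁.length = n := by rw [hxs₁def, length_extractVector_snd, hlen]
      have hxs₁F : ∀ x ∈ xs₁, IsFloat p emin x := isFloat_of_mem_extractVector_snd hfl _ xs
      have h2k := two_zpow_pos k
      split_ifs with hstop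
      · -- the loop stops: `τ₁ = fl(t + τ)` with `|t + τ| < 2ᴹσ + σ = (2ᴹ + 1)σ ∈ F`
        show |(fast2Sum fl t τ).1| ≤ (2 ^ M + 1) * (2 : ℚ) ^ k
        have hft : (fast2Sum fl t τ).1 = fl (t + τ) := rfl
        have hMp : (2 : ℤ) ^ M < 2 ^ p := pow_lt_pow_right₀ (by norm_num) hM
        have hG : IsFloat p emin (((2 ^ M + 1 : ℤ) : ℚ) * (2 : ℚ) ^ k) :=
          isFloat_of_abs_le hp (by rw [abs_of_nonneg (by positivity)]; omega) hk
        have hG' : ((2 ^ M + 1 : ℤ) : ℚ) * (2 : ℚ) ^ k = (2 ^ M + 1) * (2 : ℚ) ^ k := by push_cast; ring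
        rw [hG'] at hG
        have hsum : |t + τ| ≤ (2 ^ M + 1) * (2 : ℚ) ^ k := by
          calc |t + τ| ≤ |t| + |τ| := abs_add_le _ _
            _ ≤ (2 : ℚ) ^ (k + M) + (2 : ℚ) ^ k := add_le_add htabs hτlt.le
            _ = (2 ^ M + 1) * (2 : ℚ) ^ k := by
              rw [zpow_add₀ (by norm_num : (2 : ℚ) ≠ 0), zpow_natCast]; ring
        rw [hft]
        rw [abs_le] at hsum ⊢
        exact ⟨by have := le_fl_of_le hfl hG.neg hsum.1; linarith, fl_le_of_le hfl hG hsum.2⟩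
      · -- the loop continues: `|t'| = |fl(t + τ)| < fl(Φσ) = Φσ = 2ᴹσ'`, `σ' = 2ᴹepsσ`
        obtain ⟨hlt, hσgt⟩ := not_or.mp hstop
        have hlt : |fl (t + τ)| < fl (2 ^ (2 * M) * unitRoundoff p * (2 : ℚ) ^ k) := not_le.mp hlt
        have hσgt : (2 : ℚ) ^ (emin + p - 1) < (2 : ℚ) ^ k := not_le.mp hσgt
        have hkp : emin + p ≤ k := by
          by_contra hlt'
          have : (2 : ℚ) ^ k ≤ (2 : ℚ) ^ (emin + p - 1) := zpow_le_zpow_right₀ (by norm_num) (by omega)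
          exact absurd hσgt (not_lt.mpr this)
        have hρ : fl (2 ^ (2 * M) * unitRoundoff p * (2 : ℚ) ^ k) = (2 : ℚ) ^ (k + (2 * M : ℕ) - p) := by
          rw [two_pow_mul_u_mul_two_zpow]
          exact fl_eq_self hfl (isFloat_two_zpow hp (by push_cast; omega))
        have hσ' : fl (2 ^ M * unitRoundoff p * (2 : ℚ) ^ k) = (2 : ℚ) ^ (k + M - p) := by
          rw [two_pow_mul_u_mul_two_zpow]
          exact fl_eq_self hfl (isFloat_two_zpow hp (by omega))
        have hk' : emin ≤ k + M - p := by omega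
        have hxs₁' : ∀ x ∈ xs₁, IsFloat p emin x ∧ |x| ≤ (2 : ℚ) ^ (k + M - p - M) := by
          intro x hx
          refine ⟨hxs₁F x hx, ?_⟩
          have := hlo x hx
          rwa [u_mul_two_zpow, show k - (p : ℤ) = k + M - p - M by ring] at this
        have ht'abs : |fl (t + τ)| ≤ (2 : ℚ) ^ (k + M - p + M) := by
          rw [hρ] at hlt
          rw [show k + (M : ℤ) - p + M = k + ((2 * M : ℕ) : ℤ) - p by push_cast; ring]
          exact hlt.le
        have IH := transformPhiAux_abs_fst_le hp hfl hM hnM fuel (fl (t + τ)) (k + M - p) xs₁ hk' hlen₁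
          hxs₁' (hfl _).1 ht'abs
        rwa [hσ']

/-- For `Transform(p, 0)` with `Φ = 2^(2M)eps` (Lemma 7.2 / Algorithm 7.4, `t⁽⁰⁾ = ϱ = 0`): `|τ₁| ≤ (2ᴹ + 1)σ`
(the source: `< (2ᴹ + 2)σ`), `σ` the final extraction unit. [cite: RumpOgitaOishi2009, Lemma 7.3 (proof, the
display after (7.8))] -/
theorem abs_transformPhi_fst_le (hp : 1 ≤ p) (hfl : IsRoundNearest p emin fl) {xs : List ℚ}
    (hxs : ∀ x ∈ xs, IsFloat p emin x) (hM : Nat.clog 2 (xs.length + 2) < p) :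
    |(transformPhi fl p emin (2 ^ (2 * Nat.clog 2 (xs.length + 2)) * unitRoundoff p) xs 0).1| ≤
      (2 ^ Nat.clog 2 (xs.length + 2) + 1) *
        (transformPhi fl p emin (2 ^ (2 * Nat.clog 2 (xs.length + 2)) * unitRoundoff p) xs 0).2.2.2 := by
  by_cases hne : maxAbs xs = 0
  · rw [transformPhi_of_maxAbs_eq_zero fl p emin _ 0 hne]; simp
  · have hnM : xs.length + 2 ≤ 2 ^ Nat.clog 2 (xs.length + 2) := Nat.le_pow_clog (by norm_num) _
    obtain ⟨x, hx, hxμ⟩ := exists_abs_eq_maxAbs hne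
    have hx0 : x ≠ 0 := by intro h; rw [h, abs_zero] at hxμ; exact hne hxμ.symm
    have hμeta : (2 : ℚ) ^ emin ≤ maxAbs xs := hxμ ▸ two_zpow_emin_le_abs (hxs x hx) hx0
    have hμK : maxAbs xs ≤ (2 : ℚ) ^ Int.clog 2 (maxAbs xs) := by
      have := Int.self_le_zpow_clog (R := ℚ) (b := 2) (by norm_num) (maxAbs xs); exact_mod_cast this
    have heminK : emin ≤ Int.clog 2 (maxAbs xs) := by
      have h1 := Int.clog_mono_right (b := 2) (two_zpow_pos emin) hμeta
      have h2 : Int.clog 2 ((2 : ℚ) ^ emin) = emin := by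
        have := Int.clog_zpow (R := ℚ) (b := 2) (by norm_num) emin; exact_mod_cast this
      rwa [h2] at h1
    rw [transformPhi, if_neg hne]
    exact transformPhiAux_abs_fst_le hp hfl hM hnM _ 0 _ xs (by omega) rfl
      (fun y hy => ⟨hxs y hy, by
        rw [show ((Nat.clog 2 (xs.length + 2) : ℤ) + Int.clog 2 (maxAbs xs) - (Nat.clog 2 (xs.length + 2) : ℤ))
            = Int.clog 2 (maxAbs xs) by ring]
        exact (abs_le_maxAbs hy).trans hμK⟩)
      (isFloat_zero p emin) (by rw [abs_zero]; exact (two_zpow_pos _).le)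

/-- `|Σ p′ᵢ| ≤ n·max|p′ᵢ|`-type bound: if every `|p′ᵢ| ≤ b` then `|Σ p′ᵢ| ≤ n·b` (used with `b = epsσ`, (3.2)).
[cite: RumpOgitaOishi2009, Lemma 7.3 (proof: `|Σ p′ᵢ| ≤ 2ᴹepsσ` via (3.2), (3.14))] -/
theorem abs_sum_le_length_mul {xs : List ℚ} {b : ℚ} (h : ∀ x ∈ xs, |x| ≤ b) : |xs.sum| ≤ xs.length * b := by
  have h1 := abs_list_sum_le xs
  have h2 := List.sum_le_card_nsmul (xs.map abs) b (by
    intro y hy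
    rw [List.mem_map] at hy
    obtain ⟨x, hx, rfl⟩ := hy
    exact h x hx)
  rw [List.length_map, nsmul_eq_mul] at h2
  exact h1.trans h2

/-! ### §7, Algorithm 7.1: `DownSum` (rounding downwards) and its counterpart `UpSum` -/

/-- **ALGORITHM 7.1 (`DownSum`), accurate summation with rounding downwards**:
`[res, R, p′] = TransformK(p, 0)`; `δ = TransformK(p′, R)₁`; `if δ < 0, resD = pred(res) else resD = res`. The
predecessor function is a parameter `pred` ("computed … by Algorithm 3.5 (`NextPowerTwo`) from Part I, or by the
algorithms presented in [23]", Remark 4 after Theorem 7.5); its correctness `IsPred p emin f (pred f)` for `f ∈ F` is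
a hypothesis of the theorems. [cite: RumpOgitaOishi2009, Algorithm 7.1] -/
def downSum (fl pred : ℚ → ℚ) (p : ℕ) (emin : ℤ) (xs : List ℚ) : ℚ :=
  if (transformK fl p emin (transformK fl p emin xs 0).2.2 (transformK fl p emin xs 0).2.1).1 < 0 then
    pred (transformK fl p emin xs 0).1
  else (transformK fl p emin xs 0).1

/-- "Its counterpart looks similarly": `UpSum`, accurate summation with rounding upwards —
`[res, R, p′] = TransformK(p, 0)`; `δ = TransformK(p′, R)₁`; `if δ > 0, resU = succ(res) else resU = res`.
[cite: RumpOgitaOishi2009, Algorithm 7.1 (counterpart for rounding upwards)] -/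
def upSum (fl succ : ℚ → ℚ) (p : ℕ) (emin : ℤ) (xs : List ℚ) : ℚ :=
  if 0 < (transformK fl p emin (transformK fl p emin xs 0).2.2 (transformK fl p emin xs 0).2.1).1 then
    succ (transformK fl p emin xs 0).1
  else (transformK fl p emin xs 0).1

/-- The two extractions of Algorithm 7.1: with `[res, R, p′] = TransformK(p, 0)` and `δ = TransformK(p′, R)₁`,
`res ∈ □(s)`, "`s − res = R + Σ p′ᵢ`" (6.1), "`δ ∈ □(s − res)`" (Lemma 6.3 applied to `(p′, R)`, whose hypotheses
hold by (6.2)), `δ = 0 ⟹ s = res` (Lemma 6.3: a zero result is exact), hence `sign(δ) = sign(s − res)` ("`s < res`"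
/ "`res ≤ s`"). [cite: RumpOgitaOishi2009, Algorithm 7.1 (comments; "the proof of correctness follows
straightforwardly by Lemma 6.3 and the definition of faithful rounding")] -/
theorem transformK_transformK_spec (hfl : IsRoundNearest p emin fl) {xs : List ℚ}
    (hxs : ∀ x ∈ xs, IsFloat p emin x) (h2M : 2 * Nat.clog 2 (xs.length + 2) ≤ p) :
    IsFaithfulRounding p emin (transformK fl p emin xs 0).1 xs.sum ∧
      xs.sum - (transformK fl p emin xs 0).1 = (transformK fl p emin xs 0).2.1 + ((transformK fl p emin xs 0).2.2).sum ∧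
      IsFaithfulRounding p emin (transformK fl p emin (transformK fl p emin xs 0).2.2 (transformK fl p emin xs 0).2.1).1
        (xs.sum - (transformK fl p emin xs 0).1) ∧
      ((transformK fl p emin (transformK fl p emin xs 0).2.2 (transformK fl p emin xs 0).2.1).1 = 0 →
        xs.sum = (transformK fl p emin xs 0).1) ∧
      ((transformK fl p emin (transformK fl p emin xs 0).2.2 (transformK fl p emin xs 0).2.1).1 < 0 ↔
        xs.sum < (transformK fl p emin xs 0).1) ∧
      (0 < (transformK fl p emin (transformK fl p emin xs 0).2.2 (transformK fl p emin xs 0).2.1).1 ↔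
        (transformK fl p emin xs 0).1 < xs.sum) := by
  set res : ℚ := (transformK fl p emin xs 0).1 with hresdef
  set R : ℚ := (transformK fl p emin xs 0).2.1 with hRdef
  set xs' : List ℚ := (transformK fl p emin xs 0).2.2 with hxs'def
  obtain ⟨hfaith, h61, -, hRF, hxs'F, hlen, h62, -, -⟩ :=
    transformK_spec hfl hxs h2M (isFloat_zero p emin) (fun _ => onGrid_zero _)
  rw [add_zero] at hfaith h61
  have h2M' : 2 * Nat.clog 2 (xs'.length + 2) ≤ p := by rw [hlen]; exact h2M
  obtain ⟨hfaith₂, -, hzero₂, -, -, -, -, -, -⟩ := transformK_spec hfl hxs'F h2M' hRF h62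
  set δ : ℚ := (transformK fl p emin xs' R).1 with hδdef
  have hsum : xs'.sum + R = xs.sum - res := by rw [h61]; ring
  rw [hsum] at hfaith₂
  have hz : δ = 0 → xs.sum = res := fun h0 => by
    have := (hzero₂ h0).1; rw [hsum] at this; linarith
  obtain ⟨hs₁, hs₂, -⟩ := hfaith₂.sign
  refine ⟨hfaith, h61, hfaith₂, hz, ⟨fun hδ => ?_, fun hlt => ?_⟩, ⟨fun hδ => ?_, fun hlt => ?_⟩⟩
  · by_contra hge
    exact absurd (hs₁ (by linarith)) (not_le.mpr hδ)
  · have hle : δ ≤ 0 := hs₂ (by linarith)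
    rcases hle.lt_or_eq with h | h
    · exact h
    · exact absurd (hz h) (by linarith)
  · by_contra hge
    exact absurd (hs₂ (by linarith)) (not_le.mpr hδ)
  · have hle : 0 ≤ δ := hs₁ (by linarith)
    rcases hle.lt_or_eq with h | h
    · exact h
    · exact absurd (hz h.symm) (by linarith)

/-- **Correctness of ALGORITHM 7.1 (`DownSum`)**: for a vector `p` of `n` floating-point numbers with
`2^(2M)eps ≤ 1`, `M = ⌈log₂(n + 2)⌉`, and a correct predecessor function, `resD = DownSum(p)` is
`max{f ∈ F : f ≤ s}`, `s = Σ pᵢ` — rounding downwards. [cite: RumpOgitaOishi2009, Algorithm 7.1 ("the proof of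
correctness follows straightforwardly by Lemma 6.3 and the definition of faithful rounding")] -/
theorem downSum_spec (hfl : IsRoundNearest p emin fl) {xs : List ℚ} (hxs : ∀ x ∈ xs, IsFloat p emin x)
    (h2M : 2 * Nat.clog 2 (xs.length + 2) ≤ p) {pred : ℚ → ℚ}
    (hpred : ∀ f, IsFloat p emin f → IsPred p emin f (pred f)) :
    IsFloat p emin (downSum fl pred p emin xs) ∧ downSum fl pred p emin xs ≤ xs.sum ∧
      ∀ f, IsFloat p emin f → f ≤ xs.sum → f ≤ downSum fl pred p emin xs := by
  obtain ⟨hfaith, -, -, -, hneg, -⟩ := transformK_transformK_spec hfl hxs h2M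
  have hresF := hfaith.1
  unfold downSum
  split_ifs with hδ
  · -- `δ < 0`: `s < res`, so `pred(res) < s` (faithfulness) is the largest float `≤ s`
    have hlt := hneg.mp hδ
    have P := hpred _ hresF
    exact ⟨P.1, (hfaith.2.1 _ P.1 P.2.1).le, fun f hf hfs => P.2.2 f hf (lt_of_le_of_lt hfs hlt)⟩
  · -- `δ ≥ 0`: `res ≤ s`
    have hle : (transformK fl p emin xs 0).1 ≤ xs.sum := not_lt.mp fun h => hδ (hneg.mpr h)
    exact ⟨hresF, hle, fun f hf hfs => not_lt.mp fun h => absurd (hfaith.2.2 f hf h) (not_lt.mpr hfs)⟩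

/-- **Correctness of `UpSum`** (the counterpart of Algorithm 7.1): `resU = min{f ∈ F : s ≤ f}` — rounding
upwards. [cite: RumpOgitaOishi2009, Algorithm 7.1 (counterpart, `resU := min{f ∈ F : s ≤ f}`)] -/
theorem upSum_spec (hfl : IsRoundNearest p emin fl) {xs : List ℚ} (hxs : ∀ x ∈ xs, IsFloat p emin x)
    (h2M : 2 * Nat.clog 2 (xs.length + 2) ≤ p) {succ : ℚ → ℚ}
    (hsucc : ∀ f, IsFloat p emin f → IsSucc p emin f (succ f)) :
    IsFloat p emin (upSum fl succ p emin xs) ∧ xs.sum ≤ upSum fl succ p emin xs ∧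
      ∀ f, IsFloat p emin f → xs.sum ≤ f → upSum fl succ p emin xs ≤ f := by
  obtain ⟨hfaith, -, -, -, -, hpos⟩ := transformK_transformK_spec hfl hxs h2M
  have hresF := hfaith.1
  unfold upSum
  split_ifs with hδ
  · have hlt := hpos.mp hδ
    have S := hsucc _ hresF
    exact ⟨S.1, (hfaith.2.2 _ S.1 S.2.1).le, fun f hf hfs => S.2.2 f hf (lt_of_lt_of_le hlt hfs)⟩
  · have hle : xs.sum ≤ (transformK fl p emin xs 0).1 := not_lt.mp fun h => hδ (hpos.mpr h)
    exact ⟨hresF, hle, fun f hf hfs => not_lt.mp fun h => absurd (hfaith.2.1 f hf h) (not_lt.mpr hfs)⟩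

/-- "Note that `resD = resU` is equivalent to `s ∈ F`." [cite: RumpOgitaOishi2009, §7 (first paragraph)] -/
theorem downSum_eq_upSum_iff (hfl : IsRoundNearest p emin fl) {xs : List ℚ} (hxs : ∀ x ∈ xs, IsFloat p emin x)
    (h2M : 2 * Nat.clog 2 (xs.length + 2) ≤ p) {pred succ : ℚ → ℚ}
    (hpred : ∀ f, IsFloat p emin f → IsPred p emin f (pred f))
    (hsucc : ∀ f, IsFloat p emin f → IsSucc p emin f (succ f)) :
    downSum fl pred p emin xs = upSum fl succ p emin xs ↔ IsFloat p emin xs.sum := by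
  obtain ⟨hDF, hDle, hDmax⟩ := downSum_spec hfl hxs h2M hpred
  obtain ⟨hUF, hUge, hUmin⟩ := upSum_spec hfl hxs h2M hsucc
  constructor
  · intro h
    have : downSum fl pred p emin xs = xs.sum := le_antisymm hDle (h ▸ hUge)
    rwa [this] at hDF
  · intro hs
    rw [le_antisymm hDle (hDmax _ hs le_rfl), le_antisymm (hUmin _ hs le_rfl) hUge]

/-! ### §7, Lemma 7.2: the code (7.3) and `fl(s) ∈ {pred(res), res, succ(res)}` -/

/-- **The code (7.3)**: `[τ₁, τ₂, p′] = Transform(p, 0)` ("Parameter `Φ` replaced by `2^(2M)eps`"),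
`τ₂′ = fl(τ₂ + fl(Σ p′ᵢ))`, `[res, δ₁] = FastTwoSum(τ₁, τ₂′)` — the pair `(res, δ₁)`; these are also the first three
lines of Algorithm 7.4 (`NearSum`), where `δ₁` is called `δ`. [cite: RumpOgitaOishi2009, Lemma 7.2 eq. (7.3);
Algorithm 7.4 (lines 1–3)] -/
def resDelta (fl : ℚ → ℚ) (p : ℕ) (emin : ℤ) (xs : List ℚ) : ℚ × ℚ :=
  fast2Sum fl (transformPhi fl p emin (2 ^ (2 * Nat.clog 2 (xs.length + 2)) * unitRoundoff p) xs 0).1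
    (fl ((transformPhi fl p emin (2 ^ (2 * Nat.clog 2 (xs.length + 2)) * unitRoundoff p) xs 0).2.1 +
      flSum fl (transformPhi fl p emin (2 ^ (2 * Nat.clog 2 (xs.length + 2)) * unitRoundoff p) xs 0).2.2.1))

/-- "The first statement in Algorithm 2.4 (`FastTwoSum`) is `res = fl(τ₁ + τ₂′)`, so the result `res` computed in
(7.3) is the same as in (3.7) for `ϱ = 0`" — and the same as `TransformK(p, 0)₁` (Algorithm 6.2) and as Part I's
`AccSum(p)`. [cite: RumpOgitaOishi2009, Lemma 7.2 (proof, first sentence)] -/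
theorem resDelta_fst (fl : ℚ → ℚ) (p : ℕ) (emin : ℤ) (xs : List ℚ) :
    (resDelta fl p emin xs).1 = accSumOffset fl p emin xs 0 ∧ (resDelta fl p emin xs).1 = (transformK fl p emin xs 0).1 ∧
      (resDelta fl p emin xs).1 = accSum fl p emin xs :=
  ⟨rfl, rfl, accSumOffset_zero fl p emin xs⟩

/-- **LEMMA 7.2, the analysis of (7.3)** (its proof): with `s = Σ pᵢ` and `2^(2M)eps ≤ 1`, `res ∈ □(s)` (Lemma
3.5), "`res + δ₁ = τ₁ + τ₂′` [as in (3.12)]" (Lemma 2.5, since `|τ₂′| < |τ₁|` by (3.15)), and the two one-sided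
conclusions behind (7.4): `δ₁ ≤ 0 ⟹ fl(s) ≤ res` ("`s = res + δ₁ + δ < res + ½eps|res| ≤ M⁺(res)`, thus (7.2)
shows `fl(s) ≠ succ(res)`") and `δ₁ ≥ 0 ⟹ res ≤ fl(s)`; for the final `σ ≤ ½eps⁻¹eta` "the vector `p′` is
entirely zero and `fl(s) = fl(τ₁ + τ₂) = res`" (then `s = res + δ₁` exactly). [cite: RumpOgitaOishi2009, Lemma 7.2
(proof)] -/
theorem resDelta_spec (hfl : IsRoundNearest p emin fl) {xs : List ℚ} (hxs : ∀ x ∈ xs, IsFloat p emin x)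
    (h2M : 2 * Nat.clog 2 (xs.length + 2) ≤ p) :
    IsFaithfulRounding p emin (resDelta fl p emin xs).1 xs.sum ∧
      (resDelta fl p emin xs).1 + (resDelta fl p emin xs).2 =
        (transformPhi fl p emin (2 ^ (2 * Nat.clog 2 (xs.length + 2)) * unitRoundoff p) xs 0).1 +
          fl ((transformPhi fl p emin (2 ^ (2 * Nat.clog 2 (xs.length + 2)) * unitRoundoff p) xs 0).2.1 +
            flSum fl (transformPhi fl p emin (2 ^ (2 * Nat.clog 2 (xs.length + 2)) * unitRoundoff p) xs 0).2.2.1) ∧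
      ((resDelta fl p emin xs).2 ≤ 0 → fl xs.sum ≤ (resDelta fl p emin xs).1) ∧
      (0 ≤ (resDelta fl p emin xs).2 → (resDelta fl p emin xs).1 ≤ fl xs.sum) := by
  set M : ℕ := Nat.clog 2 (xs.length + 2) with hMdef
  set T := transformPhi fl p emin (2 ^ (2 * M) * unitRoundoff p) xs 0 with hT
  have hp : 1 ≤ p := by
    have : 1 ≤ M := Nat.clog_pos (by norm_num) (by omega)
    omega
  have hfst : (resDelta fl p emin xs).1 = fl (T.1 + fl (T.2.1 + flSum fl T.2.2.1)) := rfl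
  have hsnd : (resDelta fl p emin xs).2 = (fast2Sum fl T.1 (fl (T.2.1 + flSum fl T.2.2.1))).2 := rfl
  rw [hfst, hsnd]
  by_cases hμ : maxAbs xs = 0
  · -- the zero vector: everything vanishes
    have hz := maxAbs_eq_zero_iff.mp hμ
    have hs : xs.sum = 0 := List.sum_eq_zero hz
    have hT0 : T = (0, 0, xs, 0) := transformPhi_of_maxAbs_eq_zero fl p emin _ 0 hμ
    simp only [hT0, flSum_eq_zero hfl hz, fast2Sum, sub_self, fl_zero hfl, hs, add_zero]
    exact ⟨isFaithfulRounding_self (isFloat_zero p emin), trivial, fun _ => le_rfl, fun _ => le_rfl⟩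
  · set τ₁ : ℚ := T.1 with hτ₁
    set τ₂ : ℚ := T.2.1 with hτ₂
    set xs' : List ℚ := T.2.2.1 with hxs'
    set σ : ℚ := T.2.2.2 with hσdef
    set τ₂' : ℚ := fl (τ₂ + flSum fl xs') with hτ₂'
    set res : ℚ := fl (τ₁ + τ₂') with hres
    have hnil : xs ≠ [] := by rintro rfl; exact hμ rfl
    have hM2 : 2 ≤ M := two_le_clog_length_add_two hnil
    have hMp : M < p := by omega
    have hnM : xs.length + 2 ≤ 2 ^ M := Nat.le_pow_clog (by norm_num) _
    have H := transformPhi_spec hp hfl hxs hμ hMp (a := 2 * M) h2M (isFloat_zero p emin) (onGrid_zero _)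
    rw [add_zero] at H
    obtain ⟨hfaith, -, -⟩ :=
      accSumOffset_spec_of_maxAbs_ne_zero hfl hxs hμ h2M (isFloat_zero p emin) (onGrid_zero _)
    rw [add_zero] at hfaith
    have hfaith' : IsFaithfulRounding p emin res xs.sum := hfaith
    have hresF : IsFloat p emin res := hfaith'.1
    have hxs'F : ∀ x ∈ xs', IsFloat p emin x := fun x hx => (H.low x hx).1
    have hu0 : 0 < unitRoundoff p := u_pos
    by_cases hσ : σ ≤ (2 : ℚ) ^ (emin + p - 1)
    · -- `σ ≤ ½eps⁻¹eta`: `p′ = 0`, `τ₂′ = τ₂`, `res = fl(τ₁ + τ₂) = τ₁`, `s = τ₁ + τ₂ = res + δ₁` exactly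
      obtain ⟨hz, hs⟩ := H.eq_zero_of_le hσ
      have hτ₂'eq : τ₂' = τ₂ := by
        rw [hτ₂', flSum_eq_zero hfl hz, add_zero]; exact fl_eq_self hfl H.isFloat₂
      have hresτ₁ : res = τ₁ := by rw [hres, hτ₂'eq]; exact (H.fl_add_eq hp hfl).1
      obtain ⟨t, τ, -, -, -, -, -, -, -, -, -, hτ₂u⟩ := H.last
      have hτ₂le : |τ₂| ≤ |τ₁| :=
        hτ₂u.trans ((mul_le_mul_of_nonneg_left (ufp_le_abs τ₁) hu0.le).trans
          (mul_le_of_le_one_left (abs_nonneg _) u_le_one))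
      have hba : |τ₂'| ≤ |τ₁| := by rw [hτ₂'eq]; exact hτ₂le
      obtain ⟨-, hδ₁, -⟩ := fast2Sum_correct hp hfl H.isFloat₁ (hfl (τ₂ + flSum fl xs')).1 hba
      have hδ₁' : (fast2Sum fl τ₁ τ₂').2 = τ₁ + τ₂' - res := hδ₁
      have hs' : xs.sum = τ₁ + τ₂ := hs
      have hsδ : xs.sum = res + (fast2Sum fl τ₁ τ₂').2 := by
        rw [hδ₁', hτ₂'eq, hs', hresτ₁]; ring
      refine ⟨hfaith', by rw [hδ₁']; ring, fun h => ?_, fun h => ?_⟩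
      · exact fl_le_of_le hfl hresF (by rw [hsδ]; linarith)
      · exact le_fl_of_le hfl hresF (by rw [hsδ]; linarith)
    · -- `σ > ½eps⁻¹eta`: (6.4) `|τ₂′| ≤ |τ₁|`, FastTwoSum exact, (3.17) `|s − (τ₁ + τ₂′)| < ½eps|res|`
      push Not at hσ
      obtain ⟨hτ₃le, -, -, -, -, h317, hlast⟩ :=
        accSumOffset_estimates hfl hxs hμ h2M (isFloat_zero p emin) (onGrid_zero _) hσ
      rw [add_zero] at h317
      have h317' : 2 / unitRoundoff p * |xs.sum - (τ₁ + τ₂')| < (1 - 1 / 2 ^ M) * |res| := h317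
      have hlast' : (1 - 1 / 2 ^ M) * |res| < |res| := hlast
      have h64 := (exact_correction_of_transformPhiSpec hfl hM2 h2M hnM H hσ (isFloat_flSum hfl hxs'F)
        hτ₃le).1
      obtain ⟨-, hδ₁, -⟩ := fast2Sum_correct hp hfl H.isFloat₁ (hfl _).1 h64
      -- `|d| < ½eps|res|` for `d = s − (τ₁ + τ₂′)`
      have hd : |xs.sum - (τ₁ + τ₂')| < unitRoundoff p / 2 * |res| := by
        have h1 : |xs.sum - (τ₁ + τ₂')| = unitRoundoff p / 2 * (2 / unitRoundoff p * |xs.sum - (τ₁ + τ₂')|) := by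
          field_simp
        rw [h1]
        exact mul_lt_mul_of_pos_left (h317'.trans hlast') (by positivity)
      have hsplit : xs.sum = res + (fast2Sum fl τ₁ τ₂').2 + (xs.sum - (τ₁ + τ₂')) := by
        rw [hδ₁, ← hres]; ring
      refine ⟨hfaith', by rw [hδ₁, ← hres]; ring, fun h => ?_, fun h => ?_⟩
      · -- `s < res + ½eps|res| ≤ M⁺(res)`
        obtain ⟨c₂, hc₂⟩ := exists_isSucc hp hresF
        have hadd := (hc₂.add_le hp hresF).1
        refine fl_le_of_lt_mid_succ hfl hresF hc₂ ?_
        have := (abs_lt.mp hd).2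
        rw [hsplit]
        linarith
      · -- `M⁻(res) ≤ res − ½eps|res| < s`
        obtain ⟨c₁, hc₁⟩ := exists_isPred hp hresF
        have hsub := (hc₁.le_sub hp hresF).1
        refine le_fl_of_mid_pred_lt hfl hresF hc₁ ?_
        have := (abs_lt.mp hd).1
        rw [hsplit]
        linarith

/-- **LEMMA 7.2.** Let `p` be a vector of `n` floating-point numbers, `M := ⌈log₂(n + 2)⌉`, `2^(2M)eps ≤ 1`, and
let `res`, `δ₁` be computed by (7.3); `s := Σ pᵢ`. Then `fl(s) ∈ {pred(res), res, succ(res)}`; `δ₁ = 0` implies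
`fl(s) = res`; and (7.4): `fl(s) ∈ {pred(res), res}` if `δ₁ < 0`, `fl(s) ∈ {res, succ(res)}` if `δ₁ > 0`. Here
`fl(s)` is THE rounding to nearest `fl` applied to the real number `s` (any tie rule).
[cite: RumpOgitaOishi2009, Lemma 7.2, eq. (7.4)] -/
theorem fl_sum_mem_of_resDelta (hfl : IsRoundNearest p emin fl) {xs : List ℚ} (hxs : ∀ x ∈ xs, IsFloat p emin x)
    (h2M : 2 * Nat.clog 2 (xs.length + 2) ≤ p) :
    (fl xs.sum = (resDelta fl p emin xs).1 ∨ IsPred p emin (resDelta fl p emin xs).1 (fl xs.sum) ∨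
        IsSucc p emin (resDelta fl p emin xs).1 (fl xs.sum)) ∧
      ((resDelta fl p emin xs).2 = 0 → fl xs.sum = (resDelta fl p emin xs).1) ∧
      ((resDelta fl p emin xs).2 < 0 →
        fl xs.sum = (resDelta fl p emin xs).1 ∨ IsPred p emin (resDelta fl p emin xs).1 (fl xs.sum)) ∧
      (0 < (resDelta fl p emin xs).2 →
        fl xs.sum = (resDelta fl p emin xs).1 ∨ IsSucc p emin (resDelta fl p emin xs).1 (fl xs.sum)) := by
  have hp : 1 ≤ p := by
    have : 1 ≤ Nat.clog 2 (xs.length + 2) := Nat.clog_pos (by norm_num) (by omega)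
    omega
  obtain ⟨hfaith, -, hle, hge⟩ := resDelta_spec hfl hxs h2M
  have htri := fl_eq_or_isPred_or_isSucc hp hfl hfaith
  refine ⟨htri, fun h0 => le_antisymm (hle h0.le) (hge h0.ge), fun hlt => ?_, fun hgt => ?_⟩
  · rcases htri with h | h | h
    · exact Or.inl h
    · exact Or.inr h
    · exact absurd h.2.1 (not_lt.mpr (hle hlt.le))
  · rcases htri with h | h | h
    · exact Or.inl h
    · exact absurd h.2.1 (not_lt.mpr (hge hgt.le))
    · exact Or.inr h

/-! ### §7, Lemma 7.3: `R − δres ∈ F` and `δres ∈ epsσ′ℤ` -/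

/-- Grid halving: if `a, b ∈ 2^(j+1)ℤ` then `½(b − a) ∈ 2ʲℤ` — how (7.5) (`δres ∈ ½eps·ufp(res)ℤ` resp.
`eps·ufp(res)ℤ`) arises from `res, pred(res), succ(res) ∈ 2eps·2ᵉℤ` for a common `2ᵉ` below all three, (2.4)/(2.8).
[cite: RumpOgitaOishi2009, Lemma 7.3 (proof, eq. (7.5))] -/
theorem onGrid_half_sub {a b : ℚ} {j : ℤ} (ha : OnGrid ((2 : ℚ) ^ (j + 1)) a) (hb : OnGrid ((2 : ℚ) ^ (j + 1)) b) :
    OnGrid ((2 : ℚ) ^ j) ((b - a) / 2) := by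
  obtain ⟨m₁, hm₁⟩ := ha
  obtain ⟨m₂, hm₂⟩ := hb
  refine ⟨m₂ - m₁, ?_⟩
  rw [hm₁, hm₂, zpow_add_one₀ (by norm_num : (2 : ℚ) ≠ 0)]
  push_cast
  ring

/-- The membership test (2.10) with gradual underflow: `x ∈ 2ʲℤ ∩ etaℤ` and `|x| ≤ 2ᵖ·2ʲ` imply `x ∈ F` (for
`j ≥ emin` this is (2.10); for `j < emin` use the `eta`-grid and `|x| ≤ 2ᵖ·2ʲ ≤ 2ᵖ·eta`).
[cite: RumpOgitaOishi2009, Lemma 7.3 (proof: "with (2.10) it suffices to show `|R − δres| ≤ …`")] -/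
theorem isFloat_of_onGrid_of_onGrid_eta (hp : 1 ≤ p) {x : ℚ} {j : ℤ} (hj : OnGrid ((2 : ℚ) ^ j) x)
    (heta : OnGrid ((2 : ℚ) ^ emin) x) (hle : |x| ≤ 2 ^ p * (2 : ℚ) ^ j) : IsFloat p emin x := by
  by_cases hje : emin ≤ j
  · exact isFloat_of_onGrid_two_zpow hp hj hle hje
  · push Not at hje
    refine isFloat_of_onGrid_two_zpow hp heta (hle.trans ?_) le_rfl
    exact mul_le_mul_of_nonneg_left (zpow_le_zpow_right₀ (by norm_num) hje.le) (by positivity)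

/-- **LEMMA 7.3.** Let `p` be a vector of `n` floating-point numbers, `M := ⌈log₂(n + 2)⌉`, `2^(2M)eps ≤ 1`. Let
`res`, `R` and `p′` be the results of Algorithm 6.2 (`TransformK`) applied to `p` and `ϱ = 0`. Let
`δres ∈ {½(pred(res) − res), ½(succ(res) − res)}` (here: `δres = ½(g − res)` for `g` a neighbour of `res`) and
assume `δres ∈ F`. Then `R − δres ∈ F`. Moreover, if the vector `p′` is nonzero, then `δres ∈ epsσ′ℤ` for
`μ′ := maxᵢ |p′ᵢ|`, `σ′ := 2^(M + ⌈log₂ μ′⌉)` (so that, with (6.2), Lemma 6.3 applies to `TransformK(p′, R − δres)`).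
The source notes that the lemma fails for `ϱ ≠ 0` (`ϱ = 1`, `p = (eps²)`, `δres = −eps`); the proof here uses
`t⁽⁰⁾ = ϱ = 0` through `|τ₁| ≤ (2ᴹ + 1)σ` (`abs_transformPhi_fst_le`). [cite: RumpOgitaOishi2009, Lemma 7.3] -/
theorem transformK_sub_half_gap_spec (hfl : IsRoundNearest p emin fl) {xs : List ℚ}
    (hxs : ∀ x ∈ xs, IsFloat p emin x) (h2M : 2 * Nat.clog 2 (xs.length + 2) ≤ p) {g : ℚ}
    (hg : IsPred p emin (transformK fl p emin xs 0).1 g ∨ IsSucc p emin (transformK fl p emin xs 0).1 g)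
    (hδ : IsFloat p emin ((g - (transformK fl p emin xs 0).1) / 2)) :
    IsFloat p emin ((transformK fl p emin xs 0).2.1 - (g - (transformK fl p emin xs 0).1) / 2) ∧
      (maxAbs (transformK fl p emin xs 0).2.2 ≠ 0 →
        OnGrid (unitRoundoff p * (2 : ℚ) ^ ((Nat.clog 2 ((transformK fl p emin xs 0).2.2.length + 2) : ℤ) +
          Int.clog 2 (maxAbs (transformK fl p emin xs 0).2.2))) ((g - (transformK fl p emin xs 0).1) / 2)) := by
  have hp : 1 ≤ p := by
    have : 1 ≤ Nat.clog 2 (xs.length + 2) := Nat.clog_pos (by norm_num) (by omega)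
    omega
  have h2 : (2 : ℚ) ≠ 0 := by norm_num
  by_cases hμ : maxAbs xs = 0
  · -- the zero vector: `res = 0 ∈ U`, where the half gap `eta/2 ∉ F` — the hypothesis `δres ∈ F` is absurd
    exfalso
    have hK := transformK_of_maxAbs_eq_zero hfl hμ (isFloat_zero p emin)
    have hres : (transformK fl p emin xs 0).1 = 0 := by rw [hK]
    rw [hres] at hg hδ
    have := (half_gap_facts hp (isFloat_zero p emin) hg hδ).1
    rw [abs_zero] at this
    exact absurd this (not_lt.mpr (two_zpow_pos _).le)
  · have hnil : xs ≠ [] := by rintro rfl; exact hμ rfl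
    have hM2 : 2 ≤ Nat.clog 2 (xs.length + 2) := two_le_clog_length_add_two hnil
    have hMp : Nat.clog 2 (xs.length + 2) < p := by omega
    have hnM : xs.length + 2 ≤ 2 ^ Nat.clog 2 (xs.length + 2) := Nat.le_pow_clog (by norm_num) _
    obtain ⟨hfaith, h61, -, hRF, hxs'F, hlen, -, -, hRdef⟩ :=
      transformK_spec hfl hxs h2M (isFloat_zero p emin) (fun _ => onGrid_zero _)
    rw [add_zero] at hfaith h61
    have H := transformPhi_spec hp hfl hxs hμ hMp (a := 2 * Nat.clog 2 (xs.length + 2)) h2M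
      (isFloat_zero p emin) (onGrid_zero _)
    rw [add_zero] at H
    -- abbreviations: `M`, `[τ₁, τ₂, p′, σ] = Transform(p, 0)`, `res`, `R`, `δ′ = δres`
    set M : ℕ := Nat.clog 2 (xs.length + 2) with hMdef
    set T := transformPhi fl p emin (2 ^ (2 * M) * unitRoundoff p) xs 0 with hT
    have hxs'T : (transformK fl p emin xs 0).2.2 = T.2.2.1 := rfl
    rw [hxs'T] at hxs'F hlen h61 ⊢
    set res : ℚ := (transformK fl p emin xs 0).1 with hresdef
    set R : ℚ := (transformK fl p emin xs 0).2.1 with hRdef'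
    set τ₁ : ℚ := T.1 with hτ₁def
    set τ₂ : ℚ := T.2.1 with hτ₂def
    set xs' : List ℚ := T.2.2.1 with hxs'def
    set σ : ℚ := T.2.2.2 with hσdef
    set δ' : ℚ := (g - res) / 2 with hδ'def
    obtain ⟨k, hk, hσk⟩ := H.two_zpow
    obtain ⟨t, τ, htF, hτF, htg, hτg, hτle, hnσ, hs, h12, h1, hτ₂le⟩ := H.last
    obtain ⟨hUres, hδle⟩ := half_gap_facts hp hfaith.1 hg hδ
    have hres0 : res ≠ 0 := by
      intro h0; rw [h0, abs_zero] at hUres; exact absurd hUres (not_lt.mpr (two_zpow_pos _).le)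
    obtain ⟨E, hE⟩ := exists_ufp_eq_two_zpow hres0
    have hEle : (2 : ℚ) ^ E ≤ |res| := hE ▸ ufp_le_abs res
    have hElt : |res| < (2 : ℚ) ^ (E + 1) := by
      have := abs_lt_two_mul_ufp hres0
      rw [hE] at this
      rw [zpow_add_one₀ h2, mul_comm]; exact this
    have hEge : emin + p - 1 ≤ E := by
      by_contra hlt
      push Not at hlt
      have : (2 : ℚ) ^ (E + 1) ≤ (2 : ℚ) ^ (emin + p - 1) := zpow_le_zpow_right₀ (by norm_num) (by omega)
      linarith
    have hE1 : emin ≤ E - 1 := by omega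
    have hE1lt : (2 : ℚ) ^ (E - 1) < |res| :=
      lt_of_lt_of_le (zpow_lt_zpow_right₀ (by norm_num) (by omega)) hEle
    have hδ'F : IsFloat p emin δ' := hδ
    have hδ'le : |δ'| ≤ (2 : ℚ) ^ (E - p) := by
      have h := hδle; rw [hE, u_mul_two_zpow] at h; exact h
    have hRtt : R = t + τ - res := by rw [hRdef, ← h12]; ring
    have hsres : |xs.sum - res| < (2 : ℚ) ^ (E - p + 1) := by
      have := (faithful_abs_sub_lt_two_u_ufp hp hfaith hUres).2
      rw [hE, two_mul_u_mul_two_zpow] at this; exact this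
    have hsum' : |xs'.sum| ≤ xs.length * (unitRoundoff p * σ) := by
      have := abs_sum_le_length_mul (fun x hx => (H.low x hx).2)
      rw [H.length_eq] at this; exact this
    have hRabs : |R| ≤ |xs.sum - res| + |xs'.sum| := by
      rw [show R = (xs.sum - res) - xs'.sum by rw [h61]; ring]; exact abs_sub _ _
    have hetaG : OnGrid ((2 : ℚ) ^ emin) (R - δ') := (onGrid_eta_of_isFloat hRF).sub (onGrid_eta_of_isFloat hδ'F)
    have hnQ : (xs.length : ℚ) ≤ 2 ^ M - 2 := by
      have : ((xs.length + 2 : ℕ) : ℚ) ≤ ((2 ^ M : ℕ) : ℚ) := by exact_mod_cast hnM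
      push_cast at this; linarith
    have hM4 : (4 : ℚ) ≤ 2 ^ M := by
      calc (4 : ℚ) = 2 ^ 2 := by norm_num
        _ ≤ 2 ^ M := pow_le_pow_right₀ (by norm_num) hM2
    -- THE MECHANISM behind (7.5)/(2.10): if `2ᵉ < |res|` then `res, g ∈ 2^(e−p+1)ℤ`, so `δ′ ∈ 2^(e−p)ℤ`; if moreover
    -- `t + τ ∈ 2^(e−p)ℤ` (so `R = t + τ − res ∈ 2^(e−p)ℤ`) and `|R − δ′| ≤ 2ᵉ`, then `R − δ′ ∈ F`.
    have gridδ : ∀ e : ℤ, emin ≤ e → (2 : ℚ) ^ e < |res| → OnGrid ((2 : ℚ) ^ (e - p)) δ' := by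
      intro e he helt
      have hg' : IsFloat p emin g := hg.elim (fun h => h.1) (fun h => h.1)
      have hge : (2 : ℚ) ^ e ≤ |g| := le_abs_of_isPred_or_isSucc hg (isFloat_two_zpow hp he) helt
      exact onGrid_half_sub (onGrid_of_isFloat_of_le_abs hfaith.1 helt.le) (onGrid_of_isFloat_of_le_abs hg' hge)
    have key : ∀ e : ℤ, emin ≤ e → (2 : ℚ) ^ e < |res| → OnGrid ((2 : ℚ) ^ (e - p)) (t + τ) →
        |R - δ'| ≤ (2 : ℚ) ^ e → IsFloat p emin (R - δ') := by
      intro e he helt htτ hbd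
      have hresg : OnGrid ((2 : ℚ) ^ (e - p)) res :=
        (onGrid_of_isFloat_of_le_abs hfaith.1 helt.le).of_le (by omega)
      have hRg : OnGrid ((2 : ℚ) ^ (e - p)) (R - δ') := by
        rw [hRtt]; exact (htτ.sub hresg).sub (gridδ e he helt)
      refine isFloat_of_onGrid_of_onGrid_eta hp hRg hetaG (hbd.trans_eq ?_)
      rw [← zpow_natCast, ← zpow_add₀ h2]; congr 1; ring
    by_cases hσU : σ ≤ (2 : ℚ) ^ (emin + p - 1)
    · -- FIRST CASE `σ ≤ ½eps⁻¹eta`: `p′ = 0`, `s = τ₁ + τ₂`, `res = fl(τ₁ + τ₂) = τ₁`, `R = τ₂`; `m > 1` and the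
      -- failed "until"-condition give `|res| = |τ₁| ≤ (2ᴹ + 1)σ < 2ᴹeps⁻¹eta`, so `|R|, |δres| ≤ eps·ufp(res) ≤
      -- 2^(M−1)eta` and `R − δres ∈ etaℤ`, `|R − δres| ≤ 2ᴹeta ≤ eps⁻¹eta`: `R − δres ∈ F`.
      obtain ⟨hz, -⟩ := H.eq_zero_of_le hσU
      have hresτ₁ : res = τ₁ := by
        show fl (τ₁ + fl (τ₂ + flSum fl xs')) = τ₁
        rw [flSum_eq_zero hfl hz, add_zero, fl_eq_self hfl H.isFloat₂]
        exact (H.fl_add_eq hp hfl).1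
      have hRτ₂ : R = τ₂ := by rw [hRdef, hresτ₁]; ring
      have hres_lt : |res| < (2 : ℚ) ^ (emin + p + M) := by
        have hτ₁bd : |τ₁| ≤ (2 ^ M + 1) * σ := abs_transformPhi_fst_le hp hfl hxs hMp
        have h3 : (2 : ℚ) ^ M + 1 < 2 ^ (M + 1) := by rw [pow_succ]; linarith
        rw [hresτ₁]
        calc |τ₁| ≤ (2 ^ M + 1) * σ := hτ₁bd
          _ ≤ (2 ^ M + 1) * (2 : ℚ) ^ (emin + p - 1) := mul_le_mul_of_nonneg_left hσU (by positivity)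
          _ < 2 ^ (M + 1) * (2 : ℚ) ^ (emin + p - 1) := mul_lt_mul_of_pos_right h3 (two_zpow_pos _)
          _ = (2 : ℚ) ^ (emin + p + M) := by
            rw [← zpow_natCast, ← zpow_add₀ h2]; congr 1; push_cast; ring
      have hEub : E + 1 ≤ emin + p + M := by
        have := (zpow_lt_zpow_iff_right₀ (by norm_num : (1 : ℚ) < 2)).mp (hEle.trans_lt hres_lt)
        omega
      have hτ₂bd : |τ₂| ≤ (2 : ℚ) ^ (E - p) := by
        have h := hτ₂le
        rw [← hresτ₁, hE, u_mul_two_zpow] at h; exact h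
      have hbd : |R - δ'| ≤ 2 ^ p * (2 : ℚ) ^ emin := by
        calc |R - δ'| ≤ |R| + |δ'| := abs_sub _ _
          _ ≤ (2 : ℚ) ^ (E - p) + (2 : ℚ) ^ (E - p) := by rw [hRτ₂]; exact add_le_add hτ₂bd hδ'le
          _ = (2 : ℚ) ^ (E - p + 1) := by rw [zpow_add_one₀ h2]; ring
          _ ≤ (2 : ℚ) ^ (emin + p) := zpow_le_zpow_right₀ (by norm_num) (by omega)
          _ = 2 ^ p * (2 : ℚ) ^ emin := by rw [← zpow_natCast, ← zpow_add₀ h2, add_comm]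
      exact ⟨isFloat_of_onGrid_two_zpow hp hetaG hbd le_rfl,
        fun hμ' => absurd (maxAbs_eq_zero_iff.mpr hz) hμ'⟩
    · -- SECOND CASE `σ = 2ᵏ > ½eps⁻¹eta`: `epsσ = 2^(k−p)`, `t + τ ∈ epsσℤ`, (3.16) `|res| ≥ ⅝|τ₁|`, (3.11)
      -- `2^(2M)epsσ ≤ ufp(τ₁) = 2^E₁`
      push Not at hσU
      have hkp : emin + p ≤ k := by
        by_contra hlt
        push Not at hlt
        have : (2 : ℚ) ^ k ≤ (2 : ℚ) ^ (emin + p - 1) := zpow_le_zpow_right₀ (by norm_num) (by omega)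
        rw [hσk] at hσU; linarith
      have hσpos : 0 < σ := by rw [hσk]; exact two_zpow_pos _
      have huσ : unitRoundoff p * σ = (2 : ℚ) ^ (k - p) := by rw [hσk, u_mul_two_zpow]
      have htτg : OnGrid ((2 : ℚ) ^ (k - p)) (t + τ) := by rw [← huσ]; exact htg.add hτg
      have h58 : 5 / 8 * |τ₁| ≤ |res| :=
        (accSumOffset_estimates hfl hxs hμ h2M (isFloat_zero p emin) (onGrid_zero _) hσU).2.2.2.2.1
      have hΦ : (2 : ℚ) ^ (k + (2 * M : ℕ) - p) ≤ ufp τ₁ := by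
        have := H.phi_mul_le_ufp hσU
        rw [hσk, two_pow_mul_u_mul_two_zpow] at this; exact this
      have hτ₁0 : τ₁ ≠ 0 := by
        intro h0; rw [h0, ufp_zero] at hΦ; exact absurd hΦ (not_le.mpr (two_zpow_pos _))
      obtain ⟨E₁, hE₁⟩ := exists_ufp_eq_two_zpow hτ₁0
      have hE₁le : (2 : ℚ) ^ E₁ ≤ |τ₁| := hE₁ ▸ ufp_le_abs τ₁
      have hE₁lt : |τ₁| < (2 : ℚ) ^ (E₁ + 1) := by
        have := abs_lt_two_mul_ufp hτ₁0
        rw [hE₁] at this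
        rw [zpow_add_one₀ h2, mul_comm]; exact this
      have hkE₁ : k + 2 * M - p ≤ E₁ := by
        rw [hE₁] at hΦ
        have := (zpow_le_zpow_iff_right₀ (by norm_num : (1 : ℚ) < 2)).mp hΦ
        push_cast at this; omega
      have hE₁E : E₁ ≤ E + 1 := by
        have h1 : (2 : ℚ) ^ (E₁ - 1) < |res| := by
          have : (2 : ℚ) ^ (E₁ - 1) * 2 = (2 : ℚ) ^ E₁ := by rw [← zpow_add_one₀ h2]; congr 1; ring
          have := abs_pos.mpr hτ₁0
          linarith
        have := (zpow_lt_zpow_iff_right₀ (by norm_num : (1 : ℚ) < 2)).mp (h1.trans hElt)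
        omega
      have hW : (xs.length : ℚ) * (unitRoundoff p * σ) ≤ (2 ^ M - 2) * (2 : ℚ) ^ (k - p) := by
        rw [huσ]; exact mul_le_mul_of_nonneg_right hnQ (two_zpow_pos _).le
      have h2MW : (2 : ℚ) ^ M * (2 : ℚ) ^ (k - p) = (2 : ℚ) ^ (k + M - p) := by
        rw [← zpow_natCast, ← zpow_add₀ h2]; congr 1; ring
      have hC' : (2 ^ M - 2) * (2 : ℚ) ^ (k - p) = (2 : ℚ) ^ (k + M - p) - 2 * (2 : ℚ) ^ (k - p) := by
        rw [sub_mul, h2MW]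
      have hWpos : (0 : ℚ) < (2 : ℚ) ^ (k - p) := two_zpow_pos _
      -- `|R − δ′| ≤ |s − res| + |Σ p′ᵢ| + |δ′| < 2eps·ufp(res) + (2ᴹ − 2)epsσ + eps·ufp(res)`
      have hRδ : |R - δ'| < (2 : ℚ) ^ (E - p + 1) + ((2 : ℚ) ^ (k + M - p) - 2 * (2 : ℚ) ^ (k - p)) +
          (2 : ℚ) ^ (E - p) := by
        have h0 : |R - δ'| ≤ |R| + |δ'| := abs_sub _ _
        rw [← hC']
        linarith [hsum'.trans hW]
      -- "Moreover": `δres ∈ 2^(E−1−p)ℤ ⊆ epsσ′ℤ`, since `⌈log₂ μ′⌉ ≤ k − p` (`μ′ ≤ epsσ`) and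
      -- `2^(k+2M−p) ≤ ufp(τ₁) ≤ 2ufp(res)` give `M + ⌈log₂ μ′⌉ ≤ k + M − p ≤ E + 1 − M ≤ E − 1`
      have hδE : OnGrid ((2 : ℚ) ^ (E - 1 - p)) δ' := gridδ (E - 1) hE1 hE1lt
      have hclog2 : maxAbs xs' ≠ 0 →
          OnGrid (unitRoundoff p * (2 : ℚ) ^ ((Nat.clog 2 (xs'.length + 2) : ℤ) + Int.clog 2 (maxAbs xs'))) δ' := by
        intro hμ'
        obtain ⟨x, hx, hxμ⟩ := exists_abs_eq_maxAbs hμ'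
        have hμ'le : maxAbs xs' ≤ (2 : ℚ) ^ (k - p) := by
          rw [← hxμ]; have := (H.low x hx).2; rwa [huσ] at this
        have hμ'pos : 0 < maxAbs xs' := lt_of_le_of_ne (maxAbs_nonneg _) (Ne.symm hμ')
        have hclog : Int.clog 2 (maxAbs xs') ≤ k - p := by
          have h1 := Int.clog_mono_right (b := 2) hμ'pos hμ'le
          have h2 : Int.clog 2 ((2 : ℚ) ^ (k - p)) = k - p := by
            have := Int.clog_zpow (R := ℚ) (b := 2) (by norm_num) (k - p); exact_mod_cast this
          rwa [h2] at h1
        rw [hlen, u_mul_two_zpow]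
        exact hδE.of_le (by omega)
      refine ⟨?_, hclog2⟩
      by_cases hi : σ < |res|
      · -- `|res| > σ` (the source's last subcase): work on the grid `epsσℤ`, i.e. `e = k`; `|τ₁| ≤ (2ᴹ + 1)σ`,
        -- `|s| ≤ (2ᴹ + 2)σ ∈ F` gives `|res| ≤ (2ᴹ + 2)σ < 2^(M+1)σ`, `ufp(res) ≤ 2ᴹσ`, and then
        -- `|R − δres| < 3eps·ufp(res) + (2ᴹ − 2)epsσ < 2^(M+2)epsσ ≤ σ`
        have hsk : (2 : ℚ) ^ k < |res| := by rw [← hσk]; exact hi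
        have hpow1 : (2 : ℚ) ^ M * (2 : ℚ) ^ k = (2 : ℚ) ^ (k + M) := by
          rw [← zpow_natCast, ← zpow_add₀ h2]; congr 1; ring
        have hA : |τ₁| ≤ (2 : ℚ) ^ (k + M) + (2 : ℚ) ^ k := by
          have h0 : |τ₁| ≤ (2 ^ M + 1) * σ := abs_transformPhi_fst_le hp hfl hxs hMp
          rw [hσk, add_mul, one_mul, hpow1] at h0; exact h0
        have hB : |τ₂| ≤ (2 : ℚ) ^ (k + M - p) + (2 : ℚ) ^ (k - p) := by
          calc |τ₂| ≤ unitRoundoff p * ufp τ₁ := hτ₂le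
            _ ≤ unitRoundoff p * |τ₁| := mul_le_mul_of_nonneg_left (ufp_le_abs τ₁) u_pos.le
            _ ≤ unitRoundoff p * ((2 : ℚ) ^ (k + M) + (2 : ℚ) ^ k) := mul_le_mul_of_nonneg_left hA u_pos.le
            _ = (2 : ℚ) ^ (k + M - p) + (2 : ℚ) ^ (k - p) := by rw [mul_add, u_mul_two_zpow, u_mul_two_zpow]
        have hC : |xs'.sum| ≤ (2 : ℚ) ^ (k + M - p) - 2 * (2 : ℚ) ^ (k - p) := by
          have := hsum'.trans hW; rw [hC'] at this; exact this
        have hx1 : 2 * (2 : ℚ) ^ (k + M - p) ≤ (2 : ℚ) ^ k := by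
          calc 2 * (2 : ℚ) ^ (k + M - p) = (2 : ℚ) ^ (k + M - p + 1) := by rw [zpow_add_one₀ h2, mul_comm]
            _ ≤ (2 : ℚ) ^ k := zpow_le_zpow_right₀ (by norm_num) (by omega)
        have hs_abs : |xs.sum| ≤ (2 ^ M + 2) * σ := by
          have h0 : |xs.sum| ≤ |τ₁| + |τ₂| + |xs'.sum| := by
            rw [hs, ← h12]
            calc |τ₁ + τ₂ + xs'.sum| ≤ |τ₁ + τ₂| + |xs'.sum| := abs_add_le _ _
              _ ≤ |τ₁| + |τ₂| + |xs'.sum| := by linarith [abs_add_le τ₁ τ₂]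
          rw [hσk, add_mul, hpow1]
          linarith
        have hG : IsFloat p emin (((2 ^ M + 2 : ℤ) : ℚ) * (2 : ℚ) ^ k) := by
          refine isFloat_of_abs_le hp ?_ (by omega)
          have h0 : (2 : ℤ) ^ (M + 1) ≤ 2 ^ p := pow_le_pow_right₀ (by norm_num) (by omega)
          have h1 : (2 : ℤ) ^ 2 ≤ 2 ^ M := pow_le_pow_right₀ (by norm_num) hM2
          rw [pow_succ] at h0
          rw [abs_of_nonneg (by positivity)]
          linarith
        have hG' : ((2 ^ M + 2 : ℤ) : ℚ) * (2 : ℚ) ^ k = (2 ^ M + 2) * σ := by rw [hσk]; push_cast; ring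
        rw [hG'] at hG
        have hres_le : |res| ≤ (2 ^ M + 2) * σ := by
          rw [abs_le] at hs_abs ⊢
          exact ⟨by have := hfaith.le_of_le hG.neg (by linarith); linarith, hfaith.le_of_ge hG hs_abs.2⟩
        have hres_lt : |res| < (2 : ℚ) ^ (k + M + 1) := by
          have h3 : (2 : ℚ) ^ M + 2 < 2 ^ (M + 1) := by rw [pow_succ]; linarith
          calc |res| ≤ (2 ^ M + 2) * σ := hres_le
            _ < 2 ^ (M + 1) * σ := mul_lt_mul_of_pos_right h3 hσpos
            _ = (2 : ℚ) ^ (k + M + 1) := by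
              rw [hσk, ← zpow_natCast, ← zpow_add₀ h2]; congr 1; push_cast; ring
        have hEk : E ≤ k + M := by
          have := (zpow_lt_zpow_iff_right₀ (by norm_num : (1 : ℚ) < 2)).mp (hEle.trans_lt hres_lt); omega
        refine key k (by omega) hsk htτg ?_
        have e1 : (2 : ℚ) ^ (E - p + 1) ≤ (2 : ℚ) ^ (k + M - p + 1) := zpow_le_zpow_right₀ (by norm_num) (by omega)
        have e2 : (2 : ℚ) ^ (E - p) ≤ (2 : ℚ) ^ (k + M - p) := zpow_le_zpow_right₀ (by norm_num) (by omega)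
        have e3 : (2 : ℚ) ^ (k + M - p + 1) = 2 * (2 : ℚ) ^ (k + M - p) := by rw [zpow_add_one₀ h2, mul_comm]
        have e4 : 4 * (2 : ℚ) ^ (k + M - p) ≤ (2 : ℚ) ^ k := by
          calc 4 * (2 : ℚ) ^ (k + M - p) = (2 : ℚ) ^ (k + M - p + 1 + 1) := by
                rw [zpow_add_one₀ h2, zpow_add_one₀ h2]; ring
            _ ≤ (2 : ℚ) ^ k := zpow_le_zpow_right₀ (by norm_num) (by omega)
        linarith
      · push Not at hi
        by_cases hii : σ / 2 < |res|
        · -- `½σ < |res| ≤ σ`: grid `½epsσℤ`, i.e. `e = k − 1`; `ufp(res) ≤ σ` and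
          -- `|R − δres| < 3epsσ + (2ᴹ − 2)epsσ ≤ 2^(M+1)epsσ ≤ ½σ`
          have hsk : (2 : ℚ) ^ (k - 1) < |res| := by
            have : (2 : ℚ) ^ (k - 1) = σ / 2 := by rw [hσk, zpow_sub_one₀ h2, div_eq_mul_inv]
            rw [this]; exact hii
          have hEk : E ≤ k :=
            (zpow_le_zpow_iff_right₀ (by norm_num : (1 : ℚ) < 2)).mp (hEle.trans (hσk ▸ hi))
          refine key (k - 1) (by omega) hsk (htτg.of_le (by omega)) ?_
          have e1 : (2 : ℚ) ^ (E - p + 1) ≤ (2 : ℚ) ^ (k - p + 1) := zpow_le_zpow_right₀ (by norm_num) (by omega)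
          have e1' : (2 : ℚ) ^ (k - p + 1) = 2 * (2 : ℚ) ^ (k - p) := by rw [zpow_add_one₀ h2, mul_comm]
          have e2 : (2 : ℚ) ^ (E - p) ≤ (2 : ℚ) ^ (k - p) := zpow_le_zpow_right₀ (by norm_num) (by omega)
          have e3 : (2 : ℚ) ^ (k - p) ≤ (2 : ℚ) ^ (k + M - p) := zpow_le_zpow_right₀ (by norm_num) (by omega)
          have e4 : 2 * (2 : ℚ) ^ (k + M - p) ≤ (2 : ℚ) ^ (k - 1) := by
            calc 2 * (2 : ℚ) ^ (k + M - p) = (2 : ℚ) ^ (k + M - p + 1) := by rw [zpow_add_one₀ h2, mul_comm]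
              _ ≤ (2 : ℚ) ^ (k - 1) := zpow_le_zpow_right₀ (by norm_num) (by omega)
          linarith
        · -- `|res| ≤ ½σ`, hence `|τ₁| ≤ ⅘σ < σ` (the source's first subcase): `τ₂ = 0`, `t + τ = τ₁`,
          -- `|s| ≤ 3ufp(τ₁) ∈ F` so `ufp(res) ≤ 2ufp(τ₁)` and `τ₁ ∈ 2eps·ufp(τ₁)ℤ ⊆ ½eps·ufp(res)ℤ` (grid
          -- `e = E − 1`); with `ufp(τ₁) ≤ 2ufp(res)` and `2^(2M)epsσ ≤ ufp(τ₁)`: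
          -- `|R − δres| < 3eps·ufp(res) + (2ᴹ − 2)2^(1−2M)ufp(res) ≤ (2^(1−M) − 2^(−2M))ufp(res) ≤ ½ufp(res)`
          push Not at hii
          have hτ₁lt : |τ₁| < σ := by linarith
          have hτ₂0 : τ₂ = 0 := by
            by_contra hne
            have hτ₂g : OnGrid ((2 : ℚ) ^ (k - p)) τ₂ := by rw [← huσ]; exact (H.fl_add_eq hp hfl).2.2
            have hge := two_zpow_le_abs_of_onGrid hτ₂g hne
            have hlt : |τ₂| < (2 : ℚ) ^ (k - p) := by
              calc |τ₂| ≤ unitRoundoff p * ufp τ₁ := hτ₂le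
                _ ≤ unitRoundoff p * |τ₁| := mul_le_mul_of_nonneg_left (ufp_le_abs τ₁) u_pos.le
                _ < unitRoundoff p * σ := mul_lt_mul_of_pos_left hτ₁lt u_pos
                _ = (2 : ℚ) ^ (k - p) := huσ
            linarith
          have htτ₁ : t + τ = τ₁ := by rw [← h12, hτ₂0, add_zero]
          have hC : |xs'.sum| ≤ (2 : ℚ) ^ E₁ := by
            have h0 := hsum'.trans hW
            rw [hC'] at h0
            have : (2 : ℚ) ^ (k + M - p) ≤ (2 : ℚ) ^ E₁ := zpow_le_zpow_right₀ (by norm_num) (by omega)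
            linarith
          have hs3 : |xs.sum| ≤ 3 * (2 : ℚ) ^ E₁ := by
            have h0 : |xs.sum| ≤ |τ₁| + |xs'.sum| := by rw [hs, htτ₁]; exact abs_add_le _ _
            have h3 : (2 : ℚ) ^ (E₁ + 1) = 2 * (2 : ℚ) ^ E₁ := by rw [zpow_add_one₀ h2, mul_comm]
            linarith
          have hG : IsFloat p emin (((3 : ℤ) : ℚ) * (2 : ℚ) ^ E₁) := by
            refine isFloat_of_abs_le hp ?_ (by omega)
            have h1 : (2 : ℤ) ^ 2 ≤ 2 ^ p := pow_le_pow_right₀ (by norm_num) (by omega)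
            rw [abs_of_nonneg (by norm_num)]
            linarith
          have hG' : ((3 : ℤ) : ℚ) * (2 : ℚ) ^ E₁ = 3 * (2 : ℚ) ^ E₁ := by push_cast; ring
          rw [hG'] at hG
          have hres3 : |res| ≤ 3 * (2 : ℚ) ^ E₁ := by
            rw [abs_le] at hs3 ⊢
            exact ⟨by have := hfaith.le_of_le hG.neg (by linarith); linarith, hfaith.le_of_ge hG hs3.2⟩
          have hEE₁ : E ≤ E₁ + 1 := by
            have h0 : (2 : ℚ) ^ E < (2 : ℚ) ^ (E₁ + 1 + 1) := by
              calc (2 : ℚ) ^ E ≤ |res| := hEle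
                _ ≤ 3 * (2 : ℚ) ^ E₁ := hres3
                _ < 4 * (2 : ℚ) ^ E₁ := by linarith [two_zpow_pos E₁]
                _ = (2 : ℚ) ^ (E₁ + 1 + 1) := by rw [zpow_add_one₀ h2, zpow_add_one₀ h2]; ring
            have := (zpow_lt_zpow_iff_right₀ (by norm_num : (1 : ℚ) < 2)).mp h0; omega
          have hgrid : OnGrid ((2 : ℚ) ^ (E - 1 - p)) (t + τ) := by
            rw [htτ₁]
            exact (onGrid_of_isFloat_of_le_abs H.isFloat₁ hE₁le).of_le (by omega)
          refine key (E - 1) hE1 hE1lt hgrid ?_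
          have hY : (2 : ℚ) ^ (k - p) ≤ (2 : ℚ) ^ (E + 1 - 2 * M) := zpow_le_zpow_right₀ (by norm_num) (by omega)
          have f1 : (2 : ℚ) ^ (E - p + 1) ≤ (2 : ℚ) ^ (E + 1 - 2 * M) := zpow_le_zpow_right₀ (by norm_num) (by omega)
          have f2 : 2 * (2 : ℚ) ^ (E - p) = (2 : ℚ) ^ (E - p + 1) := by rw [zpow_add_one₀ h2, mul_comm]
          have f4 : (2 : ℚ) ^ M * (2 : ℚ) ^ (E + 1 - 2 * M) = (2 : ℚ) ^ (E + 1 - M) := by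
            rw [← zpow_natCast, ← zpow_add₀ h2]; congr 1; ring
          have f3 : (2 : ℚ) ^ (k + M - p) - 2 * (2 : ℚ) ^ (k - p) ≤
              (2 : ℚ) ^ (E + 1 - M) - 2 * (2 : ℚ) ^ (E + 1 - 2 * M) := by
            have := mul_le_mul_of_nonneg_left hY (by linarith [hM4] : (0 : ℚ) ≤ 2 ^ M - 2)
            rw [hC', sub_mul, f4] at this; exact this
          have f5 : (2 : ℚ) ^ (E + 1 - M) ≤ (2 : ℚ) ^ (E - 1) := zpow_le_zpow_right₀ (by norm_num) (by omega)
          have hYpos : (0 : ℚ) < (2 : ℚ) ^ (E + 1 - 2 * M) := two_zpow_pos _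
          linarith

/-! ### §7, Algorithm 7.4 (`NearSum`), Theorem 7.5 and Remark 1 -/

/-- Lines 8 and 10–11 of Algorithm 7.4 for a neighbour `g ∈ {pred(res), succ(res)}` of `res`, as executed in
floating-point: `γ = fl(g − res)`, `δ′ = fl(γ/2)`, `δ″ = TransformK(p′, fl(R − δ′))₁`; the pair `(δ′, δ″)`
(by Remark 1 — `nearSumAux_spec` — these three `fl`'s commit no rounding error).
[cite: RumpOgitaOishi2009, Algorithm 7.4 (lines `γ = pred(res) − res`, `δ′ = γ/2`, `δ″ = TransformK(p′, R − δ′)`)] -/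
def nearSumAux (fl : ℚ → ℚ) (p : ℕ) (emin : ℤ) (xs' : List ℚ) (res R g : ℚ) : ℚ × ℚ :=
  (fl (fl (g - res) / 2), (transformK fl p emin xs' (fl (R - fl (fl (g - res) / 2)))).1)

/-- The block `if δ < 0 … end if` of Algorithm 7.4 (given `p′`, `res`, `R`): `γ = pred(res) − res`;
`if γ = −eta, resN = res, return`; `δ′ = γ/2`; `δ″ = TransformK(p′, R − δ′)`; `if δ″ > 0, resN = res`,
`elseif δ″ < 0, resN = pred(res)`, `else resN = fl(res + δ′)`.
[cite: RumpOgitaOishi2009, Algorithm 7.4 (branch `δ < 0`: `fl(s) ∈ {pred(res), res}`)] -/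
def nearSumLo (fl pred : ℚ → ℚ) (p : ℕ) (emin : ℤ) (xs' : List ℚ) (res R : ℚ) : ℚ :=
  if fl (pred res - res) = -(2 : ℚ) ^ emin then res
  else if 0 < (nearSumAux fl p emin xs' res R (pred res)).2 then res
  else if (nearSumAux fl p emin xs' res R (pred res)).2 < 0 then pred res
  else fl (res + (nearSumAux fl p emin xs' res R (pred res)).1)

/-- The block `else … end if` of Algorithm 7.4 ("the case `δ > 0` is treated similarly"): `γ = succ(res) − res`;
`if γ = eta, resN = res, return`; `δ′ = γ/2`; `δ″ = TransformK(p′, R − δ′)`; `if δ″ < 0, resN = res`,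
`elseif δ″ > 0, resN = succ(res)`, `else resN = fl(res + δ′)`.
[cite: RumpOgitaOishi2009, Algorithm 7.4 (branch `δ > 0`: `fl(s) ∈ {res, succ(res)}`)] -/
def nearSumHi (fl succ : ℚ → ℚ) (p : ℕ) (emin : ℤ) (xs' : List ℚ) (res R : ℚ) : ℚ :=
  if fl (succ res - res) = (2 : ℚ) ^ emin then res
  else if (nearSumAux fl p emin xs' res R (succ res)).2 < 0 then res
  else if 0 < (nearSumAux fl p emin xs' res R (succ res)).2 then succ res
  else fl (res + (nearSumAux fl p emin xs' res R (succ res)).1)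

/-- **ALGORITHM 7.4 (`NearSum`), accurate summation with rounding to nearest.**
`[τ₁, τ₂, p′] = Transform(p, 0)` (parameter `Φ` replaced by `2^(2M)eps`); `τ₂′ = fl(τ₂ + (Σ p′ᵢ))`;
`[res, δ] = FastTwoSum(τ₁, τ₂′)`; `if δ = 0, resN = res, return`; `R = τ₂ − (res − τ₁)`; `if δ < 0` (block
`nearSumLo` with `pred`) `else` (block `nearSumHi` with `succ`). Lines 1–3 are the code (7.3) (`resDelta`) and,
together with line 6, exactly the computation of `[res, R, p′] = TransformK(p, 0)` (Algorithm 6.2, `transformK`: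
`res = TransformK(p, 0)₁ = (7.3)₁` by `resDelta_fst`, `R = fl(τ₂ − fl(res − τ₁)) = TransformK(p, 0)₂`,
`p′ = TransformK(p, 0)₃`), which are therefore reused. `pred` and `succ` are parameters (Remark 4: any correct
implementation), specified in `nearSum_eq_fl_sum` by `IsPred`/`IsSucc`. [cite: RumpOgitaOishi2009, Algorithm 7.4] -/
def nearSum (fl pred succ : ℚ → ℚ) (p : ℕ) (emin : ℤ) (xs : List ℚ) : ℚ :=
  if (resDelta fl p emin xs).2 = 0 then (resDelta fl p emin xs).1
  else if (resDelta fl p emin xs).2 < 0 then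
    nearSumLo fl pred p emin (transformK fl p emin xs 0).2.2 (resDelta fl p emin xs).1
      (transformK fl p emin xs 0).2.1
  else
    nearSumHi fl succ p emin (transformK fl p emin xs 0).2.2 (resDelta fl p emin xs).1
      (transformK fl p emin xs 0).2.1

/-- The heart of the proof of Theorem 7.5, for either neighbour `g ∈ {pred(res), succ(res)}` of
`res = TransformK(p, 0)₁` with `|g − res| ≠ eta`, together with REMARK 1 ("when the floating-point rounding `fl`
is omitted in Algorithm 7.4, no rounding error can occur"): `fl(g − res) = g − res` ("`γ` is always in `F`"),
`fl(γ/2) = γ/2 = δ′` (`δ′ ∈ F` since `γ ≠ ∓eta`), `fl(R − δ′) = R − δ′` (Lemma 7.3), hence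
`nearSumAux = (δ′, TransformK(p′, R − δ′)₁)`; and — (6.2) and Lemma 7.3 verify the hypotheses of Lemma 6.3 for
`TransformK(p′, R − δ′)` — `δ″ ∈ □(R − δ′ + Σ p′ᵢ) = □(s − µ)` for `µ = res + δ′`, with `δ″ = 0 ⟹ s = µ`
(Lemma 6.3: `res = 0 ⟹ res` is exact). (The remaining operations of Algorithm 7.4, `res − τ₁` and
`τ₂ − (res − τ₁)`, are exact by (6.3), `transformK_spec`.)
[cite: RumpOgitaOishi2009, Theorem 7.5 (proof: "`γ` … is always in `F`", "`δ′ ∈ F`", "`R − δ′ ∈ F`",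
"`δ″ ∈ □(R − δ′ + Σ p′ᵢ)` where `R − δ′ + Σ p′ᵢ = s − M⁻(res)`", "if `δ″ = 0`, then `s = M⁻(res)`") and Remark 1] -/
theorem nearSumAux_spec (hfl : IsRoundNearest p emin fl) {xs : List ℚ} (hxs : ∀ x ∈ xs, IsFloat p emin x)
    (h2M : 2 * Nat.clog 2 (xs.length + 2) ≤ p) {g : ℚ}
    (hg : IsPred p emin (transformK fl p emin xs 0).1 g ∨ IsSucc p emin (transformK fl p emin xs 0).1 g)
    (hne : |g - (transformK fl p emin xs 0).1| ≠ (2 : ℚ) ^ emin) :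
    fl (g - (transformK fl p emin xs 0).1) = g - (transformK fl p emin xs 0).1 ∧
    fl ((g - (transformK fl p emin xs 0).1) / 2) = (g - (transformK fl p emin xs 0).1) / 2 ∧
    fl ((transformK fl p emin xs 0).2.1 - (g - (transformK fl p emin xs 0).1) / 2) =
      (transformK fl p emin xs 0).2.1 - (g - (transformK fl p emin xs 0).1) / 2 ∧
    nearSumAux fl p emin (transformK fl p emin xs 0).2.2 (transformK fl p emin xs 0).1
        (transformK fl p emin xs 0).2.1 g =
      ((g - (transformK fl p emin xs 0).1) / 2,
        (transformK fl p emin (transformK fl p emin xs 0).2.2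
          ((transformK fl p emin xs 0).2.1 - (g - (transformK fl p emin xs 0).1) / 2)).1) ∧
    IsFaithfulRounding p emin
      (transformK fl p emin (transformK fl p emin xs 0).2.2
          ((transformK fl p emin xs 0).2.1 - (g - (transformK fl p emin xs 0).1) / 2)).1
      (xs.sum - ((transformK fl p emin xs 0).1 + (g - (transformK fl p emin xs 0).1) / 2)) ∧
    ((transformK fl p emin (transformK fl p emin xs 0).2.2
          ((transformK fl p emin xs 0).2.1 - (g - (transformK fl p emin xs 0).1) / 2)).1 = 0 →
      xs.sum = (transformK fl p emin xs 0).1 + (g - (transformK fl p emin xs 0).1) / 2) := by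
  have hp : 1 ≤ p := by
    have : 1 ≤ Nat.clog 2 (xs.length + 2) := Nat.clog_pos (by norm_num) (by omega)
    omega
  obtain ⟨hfaith, h61, -, hRF, hxs'F, hlen, h62, -, -⟩ :=
    transformK_spec hfl hxs h2M (isFloat_zero p emin) (fun _ => onGrid_zero _)
  rw [add_zero] at hfaith h61
  set res : ℚ := (transformK fl p emin xs 0).1 with hresdef
  set R : ℚ := (transformK fl p emin xs 0).2.1 with hRdef
  set xs' : List ℚ := (transformK fl p emin xs 0).2.2 with hxs'def
  have hresF : IsFloat p emin res := hfaith.1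
  have hγF : IsFloat p emin (g - res) :=
    hg.elim (fun h => isFloat_pred_sub hp hresF h) (fun h => isFloat_succ_sub hp hresF h)
  have hδ'F : IsFloat p emin ((g - res) / 2) := by
    rcases hg with h | h
    · refine isFloat_half_pred_sub hp hresF h (fun heq => hne ?_)
      rw [heq, abs_neg, abs_of_pos (two_zpow_pos _)]
    · refine isFloat_half_succ_sub hp hresF h (fun heq => hne ?_)
      rw [heq, abs_of_pos (two_zpow_pos _)]
  have L73 := transformK_sub_half_gap_spec hfl hxs h2M hg hδ'F
  have hRδF : IsFloat p emin (R - (g - res) / 2) := L73.1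
  have hδgrid : maxAbs xs' ≠ 0 →
      OnGrid (unitRoundoff p * (2 : ℚ) ^ ((Nat.clog 2 (xs'.length + 2) : ℤ) + Int.clog 2 (maxAbs xs')))
        ((g - res) / 2) := L73.2
  have e1 : fl (g - res) = g - res := fl_eq_self hfl hγF
  have e2 : fl ((g - res) / 2) = (g - res) / 2 := fl_eq_self hfl hδ'F
  have e3 : fl (R - (g - res) / 2) = R - (g - res) / 2 := fl_eq_self hfl hRδF
  have haux : nearSumAux fl p emin xs' res R g = ((g - res) / 2, (transformK fl p emin xs' (R - (g - res) / 2)).1) := by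
    simp only [nearSumAux, e1, e2, e3]
  have h2M' : 2 * Nat.clog 2 (xs'.length + 2) ≤ p := by rw [hlen]; exact h2M
  have hgrid' : maxAbs xs' ≠ 0 →
      OnGrid (unitRoundoff p * (2 : ℚ) ^ ((Nat.clog 2 (xs'.length + 2) : ℤ) + Int.clog 2 (maxAbs xs')))
        (R - (g - res) / 2) :=
    fun hμ' => (h62 hμ').sub (hδgrid hμ')
  obtain ⟨hfaith₂, -, hzero₂, -⟩ := transformK_spec hfl hxs'F h2M' hRδF hgrid'
  have hsum : xs'.sum + (R - (g - res) / 2) = xs.sum - (res + (g - res) / 2) := by linarith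
  refine ⟨e1, e2, e3, haux, ?_, fun h0 => ?_⟩
  · rw [← hsum]; exact hfaith₂
  · have := (hzero₂ h0).1
    linarith

/-- Theorem 7.5, the branch `δ < 0` (`fl(s) ∈ {pred(res), res}` by (7.4)): `γ = −eta` with `res ∈ □(s)` and
`s ∈ etaℤ` gives `res ≤ s`, so `fl(s) = res`; otherwise `δ′ = ½(pred(res) − res) ∈ F`, `M⁻(res) = res + δ′`,
`sign(s − M⁻(res)) = sign(δ″)` and the assertion follows by (7.2) if `δ″ ≠ 0`, while `δ″ = 0` gives
`s = M⁻(res)` and `fl(s) = fl(res + δ′)`. [cite: RumpOgitaOishi2009, Theorem 7.5 (proof, case `δ < 0`)] -/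
theorem nearSumLo_eq_fl_sum (hfl : IsRoundNearest p emin fl) {xs : List ℚ} (hxs : ∀ x ∈ xs, IsFloat p emin x)
    (h2M : 2 * Nat.clog 2 (xs.length + 2) ≤ p) {pred : ℚ → ℚ}
    (hpred : ∀ f, IsFloat p emin f → IsPred p emin f (pred f)) (hδ : (resDelta fl p emin xs).2 < 0) :
    nearSumLo fl pred p emin (transformK fl p emin xs 0).2.2 (transformK fl p emin xs 0).1
      (transformK fl p emin xs 0).2.1 = fl xs.sum := by
  have hp : 1 ≤ p := by
    have : 1 ≤ Nat.clog 2 (xs.length + 2) := Nat.clog_pos (by norm_num) (by omega)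
    omega
  obtain ⟨-, -, hle0, -⟩ := resDelta_spec hfl hxs h2M
  have hfl_le : fl xs.sum ≤ (transformK fl p emin xs 0).1 := hle0 hδ.le
  obtain ⟨hfaith, -, -, -, -, -, -, -, -⟩ :=
    transformK_spec hfl hxs h2M (isFloat_zero p emin) (fun _ => onGrid_zero _)
  rw [add_zero] at hfaith
  set res : ℚ := (transformK fl p emin xs 0).1 with hresdef
  set R : ℚ := (transformK fl p emin xs 0).2.1 with hRdef
  set xs' : List ℚ := (transformK fl p emin xs 0).2.2 with hxs'def
  have hresF : IsFloat p emin res := hfaith.1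
  have hg : IsPred p emin res (pred res) := hpred res hresF
  have e1 : fl (pred res - res) = pred res - res := fl_eq_self hfl (isFloat_pred_sub hp hresF hg)
  unfold nearSumLo
  rw [e1]
  by_cases hγ : pred res - res = -(2 : ℚ) ^ emin
  · -- `γ = −eta`: `pred(res) = res − eta < s` (faithfulness) and `s − res ∈ etaℤ` force `res ≤ s`, so `fl(s) = res`
    rw [if_pos hγ]
    have hlt : pred res < xs.sum := hfaith.2.1 _ hg.1 hg.2.1
    have hle : res ≤ xs.sum := by
      by_contra hlt'
      push Not at hlt'
      have hpos : 0 < res - xs.sum := by linarith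
      have hgrid : OnGrid ((2 : ℚ) ^ emin) (res - xs.sum) :=
        (onGrid_eta_of_isFloat hresF).sub (onGrid_list_sum fun x hx => onGrid_eta_of_isFloat (hxs x hx))
      have h2 := two_zpow_le_abs_of_onGrid hgrid hpos.ne'
      rw [abs_of_pos hpos] at h2
      linarith
    exact (le_antisymm hfl_le (le_fl_of_le hfl hresF hle)).symm
  · rw [if_neg hγ]
    have hne : |pred res - res| ≠ (2 : ℚ) ^ emin := by
      rw [abs_of_neg (by linarith [hg.2.1])]
      exact fun h => hγ (by linarith)
    obtain ⟨-, -, -, haux, hfaith₂, hzero₂⟩ := nearSumAux_spec hfl hxs h2M (Or.inl hg) hne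
    rw [haux]
    dsimp only
    set δ'' : ℚ := (transformK fl p emin xs' (R - (pred res - res) / 2)).1 with hδ''def
    by_cases hpos : 0 < δ''
    · -- `δ″ > 0`: `s > M⁻(res)`, so `fl(s) ≠ pred(res)` by (7.2): `fl(s) = res`
      rw [if_pos hpos]
      have hsμ : (pred res + res) / 2 < xs.sum := by
        by_contra hle
        push Not at hle
        have := hfaith₂.sign.2.1 (by linarith)
        linarith
      exact (le_antisymm hfl_le (le_fl_of_mid_pred_lt hfl hresF hg hsμ)).symm
    · rw [if_neg hpos]
      by_cases hneg : δ'' < 0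
      · -- `δ″ < 0`: `s < M⁻(res)`, so `fl(s) = pred(res)` by (7.2)
        rw [if_pos hneg]
        have hsμ : xs.sum < (pred res + res) / 2 := by
          by_contra hle
          push Not at hle
          have := hfaith₂.sign.1 (by linarith)
          linarith
        exact (fl_eq_pred_of_lt_mid_pred hfl hfaith hg hsμ).symm
      · -- `δ″ = 0`: `s = M⁻(res) = res + δ′`
        rw [if_neg hneg]
        have h0 : δ'' = 0 := le_antisymm (not_lt.mp hpos) (not_lt.mp hneg)
        rw [hzero₂ h0]

/-- Theorem 7.5, the branch `δ > 0` ("programmed and treated similarly"): `γ = eta` gives `s ≤ res` and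
`fl(s) = res`; otherwise `δ′ = ½(succ(res) − res) ∈ F`, `M⁺(res) = res + δ′`, `sign(s − M⁺(res)) = sign(δ″)`,
(7.2) for `δ″ ≠ 0` and `s = M⁺(res)` for `δ″ = 0`. [cite: RumpOgitaOishi2009, Theorem 7.5 (proof, case `δ > 0`)] -/
theorem nearSumHi_eq_fl_sum (hfl : IsRoundNearest p emin fl) {xs : List ℚ} (hxs : ∀ x ∈ xs, IsFloat p emin x)
    (h2M : 2 * Nat.clog 2 (xs.length + 2) ≤ p) {succ : ℚ → ℚ}
    (hsucc : ∀ f, IsFloat p emin f → IsSucc p emin f (succ f)) (hδ : 0 < (resDelta fl p emin xs).2) :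
    nearSumHi fl succ p emin (transformK fl p emin xs 0).2.2 (transformK fl p emin xs 0).1
      (transformK fl p emin xs 0).2.1 = fl xs.sum := by
  have hp : 1 ≤ p := by
    have : 1 ≤ Nat.clog 2 (xs.length + 2) := Nat.clog_pos (by norm_num) (by omega)
    omega
  obtain ⟨-, -, -, hge0⟩ := resDelta_spec hfl hxs h2M
  have hle_fl : (transformK fl p emin xs 0).1 ≤ fl xs.sum := hge0 hδ.le
  obtain ⟨hfaith, -, -, -, -, -, -, -, -⟩ :=
    transformK_spec hfl hxs h2M (isFloat_zero p emin) (fun _ => onGrid_zero _)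
  rw [add_zero] at hfaith
  set res : ℚ := (transformK fl p emin xs 0).1 with hresdef
  set R : ℚ := (transformK fl p emin xs 0).2.1 with hRdef
  set xs' : List ℚ := (transformK fl p emin xs 0).2.2 with hxs'def
  have hresF : IsFloat p emin res := hfaith.1
  have hg : IsSucc p emin res (succ res) := hsucc res hresF
  have e1 : fl (succ res - res) = succ res - res := fl_eq_self hfl (isFloat_succ_sub hp hresF hg)
  unfold nearSumHi
  rw [e1]
  by_cases hγ : succ res - res = (2 : ℚ) ^ emin
  · -- `γ = eta`: `s < succ(res) = res + eta` and `s − res ∈ etaℤ` force `s ≤ res`, so `fl(s) = res`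
    rw [if_pos hγ]
    have hlt : xs.sum < succ res := hfaith.2.2 _ hg.1 hg.2.1
    have hle : xs.sum ≤ res := by
      by_contra hlt'
      push Not at hlt'
      have hpos : 0 < xs.sum - res := by linarith
      have hgrid : OnGrid ((2 : ℚ) ^ emin) (xs.sum - res) :=
        (onGrid_list_sum fun x hx => onGrid_eta_of_isFloat (hxs x hx)).sub (onGrid_eta_of_isFloat hresF)
      have h2 := two_zpow_le_abs_of_onGrid hgrid hpos.ne'
      rw [abs_of_pos hpos] at h2
      linarith
    exact (le_antisymm (fl_le_of_le hfl hresF hle) hle_fl).symm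
  · rw [if_neg hγ]
    have hne : |succ res - res| ≠ (2 : ℚ) ^ emin := by
      rw [abs_of_pos (by linarith [hg.2.1])]; exact hγ
    obtain ⟨-, -, -, haux, hfaith₂, hzero₂⟩ := nearSumAux_spec hfl hxs h2M (Or.inr hg) hne
    rw [haux]
    dsimp only
    set δ'' : ℚ := (transformK fl p emin xs' (R - (succ res - res) / 2)).1 with hδ''def
    by_cases hneg : δ'' < 0
    · -- `δ″ < 0`: `s < M⁺(res)`, so `fl(s) ≠ succ(res)` by (7.2): `fl(s) = res`
      rw [if_pos hneg]
      have hsμ : xs.sum < (res + succ res) / 2 := by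
        by_contra hle
        push Not at hle
        have := hfaith₂.sign.1 (by linarith)
        linarith
      exact (le_antisymm (fl_le_of_lt_mid_succ hfl hresF hg hsμ) hle_fl).symm
    · rw [if_neg hneg]
      by_cases hpos : 0 < δ''
      · -- `δ″ > 0`: `s > M⁺(res)`, so `fl(s) = succ(res)` by (7.2)
        rw [if_pos hpos]
        have hsμ : (res + succ res) / 2 < xs.sum := by
          by_contra hle
          push Not at hle
          have := hfaith₂.sign.2.1 (by linarith)
          linarith
        exact (fl_eq_succ_of_mid_succ_lt hfl hfaith hg hsμ).symm
      · -- `δ″ = 0`: `s = M⁺(res) = res + δ′`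
        rw [if_neg hpos]
        have h0 : δ'' = 0 := le_antisymm (not_lt.mp hpos) (not_lt.mp hneg)
        rw [hzero₂ h0]

/-- **THEOREM 7.5.** Let `p` be a vector of `n` floating-point numbers, `M := ⌈log₂(n + 2)⌉`, and assume
`2^(2M)eps ≤ 1`. Let `resN` be the result of Algorithm 7.4 (`NearSum`) applied to `p` (with correct `pred`/`succ`,
Remark 4). Then `resN = fl(s)` is the rounded-to-nearest exact sum `s := Σ pᵢ` — for the SAME rounding to nearest
`fl` (any tie rule) that the algorithm executes. Proof as in the source: Lemma 7.2 (`δ = 0 ⟹ fl(s) = res`, (7.4)),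
then `nearSumLo_eq_fl_sum` / `nearSumHi_eq_fl_sum`. [cite: RumpOgitaOishi2009, Theorem 7.5] -/
theorem nearSum_eq_fl_sum (hfl : IsRoundNearest p emin fl) {xs : List ℚ} (hxs : ∀ x ∈ xs, IsFloat p emin x)
    (h2M : 2 * Nat.clog 2 (xs.length + 2) ≤ p) {pred succ : ℚ → ℚ}
    (hpred : ∀ f, IsFloat p emin f → IsPred p emin f (pred f))
    (hsucc : ∀ f, IsFloat p emin f → IsSucc p emin f (succ f)) :
    nearSum fl pred succ p emin xs = fl xs.sum := by
  obtain ⟨-, hδzero, -, -⟩ := fl_sum_mem_of_resDelta hfl hxs h2M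
  unfold nearSum
  split_ifs with h0 hneg
  · exact (hδzero h0).symm
  · exact nearSumLo_eq_fl_sum hfl hxs h2M hpred hneg
  · exact nearSumHi_eq_fl_sum hfl hxs h2M hsucc (lt_of_le_of_ne (not_lt.mp hneg) (Ne.symm h0))

/-- Theorem 7.5, corollary: `NearSum(p) ∈ F` is a (indeed the nearest) faithful rounding of `s`, and `NearSum(p) = s`
whenever `s ∈ F`. [cite: RumpOgitaOishi2009, Theorem 7.5] -/
theorem nearSum_faithful (hfl : IsRoundNearest p emin fl) {xs : List ℚ} (hxs : ∀ x ∈ xs, IsFloat p emin x)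
    (h2M : 2 * Nat.clog 2 (xs.length + 2) ≤ p) {pred succ : ℚ → ℚ}
    (hpred : ∀ f, IsFloat p emin f → IsPred p emin f (pred f))
    (hsucc : ∀ f, IsFloat p emin f → IsSucc p emin f (succ f)) :
    IsFaithfulRounding p emin (nearSum fl pred succ p emin xs) xs.sum ∧
      (IsFloat p emin xs.sum → nearSum fl pred succ p emin xs = xs.sum) := by
  rw [nearSum_eq_fl_sum hfl hxs h2M hpred hsucc]
  exact ⟨isFaithfulRounding_fl hfl _, fun h => fl_eq_self hfl h⟩

end Literature.ComputerArithmetic.RumpOgitaOishi2009
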